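import Literature.Geometry.Riemannian.EigenvaluePinchingSphereMoserProofs
import Literature.Geometry.Lorentzian.MetricDetComparison
import Literature.Geometry.Lorentzian.GreenIdentityCompactSupport
import Mathlib.Analysis.InnerProductSpace.Trace
import Mathlib.Analysis.Matrix.Hermitian
import HarnessLib

/-!
# Karpukhin–Stern §3.1: the Bochner identity and inequality (3.3) for sphere-valued harmonic maps
(second proof file of `KarpukhinSternHarmonicMaps.lean`; topic `Geometry/Riemannian`)

Continuation of `KarpukhinSternHarmonicMapsProofs.lean` toward
`Literature.Geometry.Riemannian.karpukhinStern_groundStateHarmonicMap` (Karpukhin–Stern,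
Invent. Math. 236 (2024), Cor. 1.3 with Thm. 1.5). That file proved KS Lemma 3.3 (p. 747), the
index calculus of §4 and the endgame of Thm. 4.6; the next printed step of §3.1 (p. 747–748) is
the Bochner identity for `Sᵏ`-valued harmonic maps and its consequence (3.3),

  `−½ Δ|du|² ≥ (n/(n−1)) |d|du||² − ‖Ric_M‖ |du|² − ((n−1)/n) |du|⁴`,

the pointwise engine of Lemma 3.4 and of the `L⁶` estimates of Prop. 3.5. Everything below is
PROVED (no definitions, no named facts), in the vocabulary of the fact and of the first proof file
(`dalembertian = tr_h Hess`, `innerDual = h⁻¹`, `gradSq`, `normSq`, `ricci`, `sharp`,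
`KarpukhinStern.energyDensity h u = |du|²_h`):

* Part A — the linear algebra of the **refined Kato inequality** [38, Prop. 2.3] quoted on p. 748:
  `mul_sq_le_of_sum_eq_zero`, `traceless_isSymmetric_norm_sq_le` (a traceless symmetric operator
  on a `d`-dimensional inner product space has `d ‖Tv‖² ≤ (d − 1) ‖T‖²_{HS} ‖v‖²`, spectral
  theorem), its matrix form `traceless_symm_mulVec_sq_le` and the vector-valued form
  `traceless_symm_sum_mulVec_sq_le` (`d |∑ᵢ Aⁱvⁱ|² ≤ (d − 1)(∑ᵢ|Aⁱ|²)(∑ᵢ|vⁱ|²)`).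
* Part B — metric contractions in an orthonormal frame of a Riemannian fibre
  (`innerDual_eq_sum_frame`, `normSq_eq_sum_frame`, `trace_eq_sum_frame`, `sharp_eq_sum_frame`,
  `bilin_sharp_eq_sum_frame`, `exists_frame`).
* Part C — `hessianAux_finset_sum`, `hessian_finset_sum`, `hessian_sq` and
  **`sum_sphereCoord_mul_hessian`: `∑ᵢ uᵢ Hess uᵢ = −du*du`** for a sphere-valued map (the normal
  part of the `ℝᵏ⁺¹`-valued Hessian, p. 748: `Hess(u) = Hess(u)ᵀ − u ⊗ du*du`).
* Part D — `dalembertian_energyDensity_eq`: **the Bochner identity** for a smooth harmonic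
  `u : N → Sᵏ`, `tr_h Hess |du|² = 2∑ᵢ|Hess uᵢ|² + 2∑ᵢ Ric(∇uᵢ,∇uᵢ) − 2|du|⁴` (p. 747), and
  **`kato_bochner_energyDensity` = (3.3) multiplied by `|du|²`**: with `e = |du|²`,
  `R = tr_h Hess e + 2Ke + (2 − 2/m)e²` and `Ric ≥ −K h`, `0 ≤ R` and `m h⁻¹(de,de) ≤ 2(m−1) e R`
  (`sq_trace_le_card_mul_sum_sq` is `∑⟨du(eₐ),du(e_b)⟩² ≥ |du|⁴/n`).
* Part E — **Karpukhin–Stern Lemma 3.4** (p. 749), for every real `α ≥ 2` with explicit constants: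
  `gradSq_rpow_le_dalembertian_rpow` (the regularised pointwise bound
  `|d(e+t)^{α/4}|² ≤ Q[(1/α) tr Hess (e+t)^{α/2} + (e+t)^{α/2−1}(Ke + ((m−1)/m)e²)]`,
  `Q = Q(m, α) = α²/(4(m/(m−1) + α − 2))`, p. 748), `gradSq_mul_eq`, the dominated-convergence
  limit `tendsto_integral_mul_add_rpow`, and `karpukhinStern_lemma34`:
  `(k−2−M)∫φ²e^{α/2+1} ≤ (k−M+1)[∫e^{α/2}|dφ|² + (Q/α−½)∫e^{α/2} tr Hess(φ²) + QK∫φ²e^{α/2}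
   + Q((m−1)/m)∫φ²e^{α/2+1}]` for smooth `φ` with `tsupport φ ⊆ Ω`, `ind_E(u; Ω) ≤ M`, `M + 2 < k`
  (Lemma 3.3 for `ψ = φ(e+t)^{α/4}`, Green, `t → 0⁺`).
* Part F — **Proposition 3.5, analytic core** (pp. 749–750): `energyIndexOn_mono`
  (`ind_E(u; Ω) ≤ ind_E(u; Ω')` for `Ω ⊆ Ω'`), `abs_integral_mul_le_mul_setIntegral`,
  `karpukhinStern_lemma34_cutoff` (Lemma 3.4 for a cut-off `|φ| ≤ 1`, `|dφ|² ≤ a`,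
  `|tr Hess(φ²)| ≤ b`: `((k−2−M) − (k−M+1)P) ∫φ²e^{α/2+1} ≤ (k−M+1)(a + |Q/α−½|b + QK) ∫_Ω e^{α/2}`),
  the numerics `prop35_constants_pos`/`prop35_constants_eq` (`200/203 − P(m,2) > 0`,
  `200/203 − P(m,4) > 0` for `2 ≤ m ≤ 5`) and **`karpukhinStern_prop35_core`**: for
  `S₁ ⊆ Ω₂ ⊆ Ω₃` with cut-offs `φ₁` (`= 1` on `Ω₂`, supported in `Ω₃`) and `φ₂` (`= 1` on `S₁`,
  supported in `Ω₂`) and `ind_E(u; Ω₃) ≤ k − 202`, `∫_{S₁} e³ ≤ C₄ C₂ ∫_{Ω₃} e` with explicit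
  `C₂, C₄` — the two applications `α = 2`, `α = 4` of Lemma 3.4 in print (the cut-offs on geodesic
  balls are hypotheses here).
* Part G — toward Lemmas 3.6–3.7 and Prop. 5.5: `negIndex_comp_add_negIndex_comp_le` and
  **`energyIndexOn_add_le`** (`ind_E(u; Ω₁) + ind_E(u; Ω₂) ≤ ind_E(u)` for disjoint `Ω₁, Ω₂`,
  p. 752), `energyIndexOn_le_three` (the step `ind_E(u; B_δ) ≤ 3` of Lemma 3.7),
  `integral_gradSq_energyDensity_le` (the `W^{1,2}` bound (3.9) from (3.3) and Green),
  `energyDensity_eq_zero_of_sphereComp_pos` / `apply_eq_of_sphereComp_pos` (a harmonic map into an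
  open hemisphere is constant — the last step of the proof of Prop. 5.5, p. 776).

## References

* M. Karpukhin, D. Stern, *Existence of harmonic maps and eigenvalue optimization in higher
  dimensions*, Invent. Math. 236 (2024) 713–778, §3.1, pp. 747–748 (Bochner identity, refined Kato
  inequality, (3.3)), Lemma 3.4 p. 749, Prop. 3.5 pp. 749–750, Lemma 3.7 p. 752, Prop. 5.5 p. 776.
  [KarpukhinStern2024]
* B. O'Neill, *Semi-Riemannian geometry*, Academic Press 1983, Ch. 3, pp. 60–61, Def. 3.48–3.50,
  Lemma 3.49. [ONeill1983]
-/

noncomputable section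

open Module Finset
open scoped InnerProductSpace BigOperators Manifold ContDiff Topology

namespace Literature.Geometry.Riemannian

namespace KarpukhinStern

/-! ### Part A — the algebra of the refined Kato inequality -/

section KatoAlgebra

/-- If `∑ⱼ λⱼ = 0` then `d λⱼ² ≤ (d − 1) ∑ᵢ λᵢ²` for each `j` (Cauchy–Schwarz on `λⱼ = −∑_{i≠j} λᵢ`). [folklore] -/
theorem mul_sq_le_of_sum_eq_zero {d : ℕ} (lam : Fin d → ℝ) (hsum : ∑ j, lam j = 0) (j : Fin d) :
    (d : ℝ) * lam j ^ 2 ≤ ((d : ℝ) - 1) * ∑ i, lam i ^ 2 := by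
  classical
  have hd1 : 1 ≤ d := Fin.pos j
  have hj : lam j = -∑ i ∈ univ.erase j, lam i := by
    have := Finset.add_sum_erase univ lam (mem_univ j)
    linarith
  have hcs : (∑ i ∈ univ.erase j, lam i) ^ 2 ≤
      (univ.erase j).card * ∑ i ∈ univ.erase j, lam i ^ 2 := sq_sum_le_card_mul_sum_sq
  have hcard : (((univ : Finset (Fin d)).erase j).card : ℝ) = d - 1 := by
    rw [Finset.card_erase_of_mem (mem_univ j), card_univ, Fintype.card_fin, Nat.cast_sub hd1,
      Nat.cast_one]
  have hsplit : ∑ i, lam i ^ 2 = lam j ^ 2 + ∑ i ∈ univ.erase j, lam i ^ 2 :=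
    (Finset.add_sum_erase univ (fun i ↦ lam i ^ 2) (mem_univ j)).symm
  have h1 : lam j ^ 2 ≤ ((d : ℝ) - 1) * ∑ i ∈ univ.erase j, lam i ^ 2 := by
    rw [hj, neg_sq, ← hcard]
    exact hcs
  have hexp : (d : ℝ) * lam j ^ 2 = lam j ^ 2 + ((d : ℝ) - 1) * lam j ^ 2 := by ring
  rw [hsplit, hexp, mul_add]
  linarith

/-- **A traceless symmetric operator has small operator norm**: on a real inner product space of
dimension `d`, if `T` is symmetric with `tr T = 0` then `d ‖T v‖² ≤ (d − 1) ‖T‖²_{HS} ‖v‖²`,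
`‖T‖²_{HS} = ∑ᵢ ‖T eᵢ‖²` in any orthonormal basis (spectral theorem: `‖Tv‖² = ∑ λⱼ² ⟨bⱼ, v⟩²`,
`∑ λⱼ = 0`, and `mul_sq_le_of_sum_eq_zero`). This is the linear algebra of the refined Kato
inequality for harmonic maps (Karpukhin–Stern p. 748, from [38, Prop. 2.3]).
[cite: KarpukhinStern2024, §3.1 p. 748] -/
theorem traceless_isSymmetric_norm_sq_le {E : Type*} [NormedAddCommGroup E] [InnerProductSpace ℝ E]
    [FiniteDimensional ℝ E] {ι : Type*} [Fintype ι] {d : ℕ} (hd : finrank ℝ E = d)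
    {T : E →ₗ[ℝ] E} (hT : T.IsSymmetric) (htr : LinearMap.trace ℝ E T = 0)
    (e : OrthonormalBasis ι ℝ E) (v : E) :
    (d : ℝ) * ‖T v‖ ^ 2 ≤ ((d : ℝ) - 1) * (∑ i, ‖T (e i)‖ ^ 2) * ‖v‖ ^ 2 := by
  classical
  set b := hT.eigenvectorBasis hd with hb
  set lam : Fin d → ℝ := hT.eigenvalues hd with hlam
  have happ : ∀ j, T (b j) = lam j • b j := fun j ↦ hT.apply_eigenvectorBasis hd j
  -- `tr T = 0 ⇒ ∑ λ = 0`
  have hsum : ∑ j, lam j = 0 := by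
    have h := hT.trace_eq_sum_eigenvalues hd
    rw [htr] at h
    simpa using h.symm
  -- `‖T w‖² = ∑ⱼ λⱼ² ⟨bⱼ, w⟩²`
  have hnorm : ∀ w : E, ‖T w‖ ^ 2 = ∑ j, lam j ^ 2 * ⟪b j, w⟫_ℝ ^ 2 := by
    intro w
    have h1 : ‖T w‖ ^ 2 = ∑ j, ⟪T w, b j⟫_ℝ * ⟪b j, T w⟫_ℝ := by
      rw [b.sum_inner_mul_inner, real_inner_self_eq_norm_sq]
    rw [h1]
    refine sum_congr rfl fun j _ ↦ ?_
    have h2 : ⟪b j, T w⟫_ℝ = lam j * ⟪b j, w⟫_ℝ := by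
      rw [← hT (b j) w, happ, real_inner_smul_left]
    rw [real_inner_comm, h2]
    ring
  -- `‖w‖² = ∑ⱼ ⟨bⱼ, w⟩²`
  have hpar : ∀ w : E, ‖w‖ ^ 2 = ∑ j, ⟪b j, w⟫_ℝ ^ 2 := by
    intro w
    rw [← real_inner_self_eq_norm_sq, ← b.sum_inner_mul_inner]
    refine sum_congr rfl fun j _ ↦ ?_
    rw [real_inner_comm]
    ring
  -- `∑ᵢ ‖T eᵢ‖² = ∑ⱼ λⱼ²`
  have hHS : ∑ i, ‖T (e i)‖ ^ 2 = ∑ j, lam j ^ 2 := by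
    simp_rw [hnorm]
    rw [Finset.sum_comm]
    refine sum_congr rfl fun j _ ↦ ?_
    rw [← Finset.mul_sum]
    have h1 : ∑ i, ⟪b j, e i⟫_ℝ ^ 2 = ‖b j‖ ^ 2 := by
      rw [← real_inner_self_eq_norm_sq, ← e.sum_inner_mul_inner]
      refine sum_congr rfl fun i _ ↦ ?_
      rw [real_inner_comm (e i)]
      ring
    rw [h1, b.orthonormal.norm_eq_one j]
    ring
  rw [hHS, hnorm v, hpar v, Finset.mul_sum, Finset.mul_sum]
  refine Finset.sum_le_sum fun j _ ↦ ?_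
  have hj := mul_sq_le_of_sum_eq_zero lam hsum j
  have hc : 0 ≤ ⟪b j, v⟫_ℝ ^ 2 := sq_nonneg _
  calc (d : ℝ) * (lam j ^ 2 * ⟪b j, v⟫_ℝ ^ 2) = ((d : ℝ) * lam j ^ 2) * ⟪b j, v⟫_ℝ ^ 2 := by ring
    _ ≤ (((d : ℝ) - 1) * ∑ i, lam i ^ 2) * ⟪b j, v⟫_ℝ ^ 2 := mul_le_mul_of_nonneg_right hj hc
    _ = ((d : ℝ) - 1) * (∑ i, lam i ^ 2) * ⟪b j, v⟫_ℝ ^ 2 := by ring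

/-- **Matrix form**: for a symmetric `d × d` real matrix `A` with `∑ₐ A_{aa} = 0` and `v ∈ ℝᵈ`,
`d |A v|² ≤ (d − 1) |A|² |v|²` (`|A|² = ∑ A_{ab}²`). [cite: KarpukhinStern2024, §3.1 p. 748] -/
theorem traceless_symm_mulVec_sq_le {d : ℕ} (A : Fin d → Fin d → ℝ) (hA : ∀ a b, A a b = A b a)
    (htr : ∑ a, A a a = 0) (v : Fin d → ℝ) :
    (d : ℝ) * ∑ b, (∑ a, A b a * v a) ^ 2 ≤
      ((d : ℝ) - 1) * (∑ a, ∑ b, A b a ^ 2) * ∑ a, v a ^ 2 := by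
  classical
  set Am : Matrix (Fin d) (Fin d) ℝ := Matrix.of A with hAm
  set T : EuclideanSpace ℝ (Fin d) →ₗ[ℝ] EuclideanSpace ℝ (Fin d) := Matrix.toEuclideanLin Am with hT
  have hTapp : ∀ (x : EuclideanSpace ℝ (Fin d)) (b : Fin d), T x b = ∑ a, A b a * x a := by
    intro x b
    rw [hT]
    simp [Matrix.toLpLin_apply, Matrix.mulVec, dotProduct, hAm]
  have hHerm : Am.IsHermitian := by
    refine Matrix.IsHermitian.ext fun i j ↦ ?_
    simp [hAm, hA j i]
  have hTs : T.IsSymmetric := Matrix.isSymmetric_toEuclideanLin_iff.mpr hHerm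
  set e := EuclideanSpace.basisFun (Fin d) ℝ with he
  have heapp : ∀ a c : Fin d, (e a) c = if c = a then 1 else 0 := by
    intro a c
    rw [he, EuclideanSpace.basisFun_apply]
    simp [PiLp.single_apply]  -- may need adjustment
  have hTe : ∀ a b, T (e a) b = A b a := by
    intro a b
    rw [hTapp]
    simp_rw [heapp]
    simp
  have hinner : ∀ (a : Fin d) (x : EuclideanSpace ℝ (Fin d)), ⟪e a, x⟫_ℝ = x a := by
    intro a x
    rw [he, EuclideanSpace.basisFun_apply, EuclideanSpace.inner_single_left]
    simp
  have htrT : LinearMap.trace ℝ _ T = 0 := by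
    rw [T.trace_eq_sum_inner e]
    simp_rw [hinner, hTe]
    exact htr
  have hd : finrank ℝ (EuclideanSpace ℝ (Fin d)) = d := finrank_euclideanSpace_fin
  set w : EuclideanSpace ℝ (Fin d) := WithLp.toLp 2 v with hw
  have key := traceless_isSymmetric_norm_sq_le hd hTs htrT e w
  have h1 : ‖T w‖ ^ 2 = ∑ b, (∑ a, A b a * v a) ^ 2 := by
    rw [EuclideanSpace.real_norm_sq_eq]
    refine sum_congr rfl fun b _ ↦ ?_
    rw [hTapp]
  have h2 : ∑ i, ‖T (e i)‖ ^ 2 = ∑ a, ∑ b, A b a ^ 2 := by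
    refine sum_congr rfl fun a _ ↦ ?_
    rw [EuclideanSpace.real_norm_sq_eq]
    refine sum_congr rfl fun b _ ↦ ?_
    rw [hTe]
  have h3 : ‖w‖ ^ 2 = ∑ a, v a ^ 2 := by
    rw [EuclideanSpace.real_norm_sq_eq]
  rw [h1, h2, h3] at key
  exact key

/-- **Vector-valued form** (sum over the components `i`): for symmetric traceless `d × d`
matrices `Aⁱ` and vectors `vⁱ ∈ ℝᵈ`, `d |∑ᵢ Aⁱ vⁱ|² ≤ (d − 1) (∑ᵢ |Aⁱ|²)(∑ᵢ |vⁱ|²)` (the matrix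
form, the triangle inequality in `ℝᵈ` and Cauchy–Schwarz over `i`). With `Aⁱ` the tangential
Hessian of the `i`-th coordinate of a harmonic map `u : M → Sᵏ ⊂ ℝᵏ⁺¹` and `vⁱ = duᵢ` this is the
refined Kato inequality `|Hess(u)ᵀ|² ≥ (n/(n−1)) |d|du||²` of Karpukhin–Stern p. 748
([38, Prop. 2.3]). [cite: KarpukhinStern2024, §3.1 p. 748] -/
theorem traceless_symm_sum_mulVec_sq_le {ι : Type*} [Fintype ι] {d : ℕ}
    (A : ι → Fin d → Fin d → ℝ) (hA : ∀ i a b, A i a b = A i b a) (htr : ∀ i, ∑ a, A i a a = 0)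
    (v : ι → Fin d → ℝ) :
    (d : ℝ) * ∑ b, (∑ i, ∑ a, A i b a * v i a) ^ 2 ≤
      ((d : ℝ) - 1) * (∑ i, ∑ a, ∑ b, A i b a ^ 2) * ∑ i, ∑ a, v i a ^ 2 := by
  classical
  rcases Nat.eq_zero_or_pos d with hd | hd
  · subst hd
    simp
  set w : ι → EuclideanSpace ℝ (Fin d) :=
    fun i ↦ WithLp.toLp 2 (fun b ↦ ∑ a, A i b a * v i a) with hw
  set P : ι → ℝ := fun i ↦ ∑ a, ∑ b, A i b a ^ 2 with hP
  set R : ι → ℝ := fun i ↦ ∑ a, v i a ^ 2 with hR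
  set c : ℝ := ((d : ℝ) - 1) / d with hc
  have hd' : (0 : ℝ) < d := by exact_mod_cast hd
  have hd1 : (1 : ℝ) ≤ d := by exact_mod_cast hd
  have hc0 : 0 ≤ c := div_nonneg (by linarith) hd'.le
  have hP0 : ∀ i, 0 ≤ P i := fun i ↦ sum_nonneg fun a _ ↦ sum_nonneg fun b _ ↦ sq_nonneg _
  have hR0 : ∀ i, 0 ≤ R i := fun i ↦ sum_nonneg fun a _ ↦ sq_nonneg _
  have hwapp : ∀ i b, w i b = ∑ a, A i b a * v i a := fun i b ↦ rfl
  -- each `‖wᵢ‖² ≤ c Pᵢ Rᵢ`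
  have hwi : ∀ i, ‖w i‖ ^ 2 ≤ c * (P i * R i) := by
    intro i
    have h := traceless_symm_mulVec_sq_le (A i) (hA i) (htr i) (v i)
    have hn : ‖w i‖ ^ 2 = ∑ b, (∑ a, A i b a * v i a) ^ 2 := by
      rw [EuclideanSpace.real_norm_sq_eq]
    rw [hn, hc, div_mul_eq_mul_div, le_div_iff₀ hd']
    have hPR : P i * R i = (∑ a, ∑ b, A i b a ^ 2) * ∑ a, v i a ^ 2 := rfl
    rw [hPR, ← mul_assoc]
    linarith
  have hwi' : ∀ i, ‖w i‖ ≤ Real.sqrt c * (Real.sqrt (P i) * Real.sqrt (R i)) := by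
    intro i
    have h1 : ‖w i‖ = Real.sqrt (‖w i‖ ^ 2) := (Real.sqrt_sq (norm_nonneg _)).symm
    rw [h1, ← Real.sqrt_mul (hP0 i), ← Real.sqrt_mul hc0]
    exact Real.sqrt_le_sqrt (hwi i)
  -- the triangle inequality and Cauchy–Schwarz over `i`
  have hsum : ‖∑ i, w i‖ ≤ Real.sqrt c * ∑ i, Real.sqrt (P i) * Real.sqrt (R i) := by
    calc ‖∑ i, w i‖ ≤ ∑ i, ‖w i‖ := norm_sum_le _ _
      _ ≤ ∑ i, Real.sqrt c * (Real.sqrt (P i) * Real.sqrt (R i)) := sum_le_sum fun i _ ↦ hwi' i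
      _ = Real.sqrt c * ∑ i, Real.sqrt (P i) * Real.sqrt (R i) := by rw [mul_sum]
  have hCS : (∑ i, Real.sqrt (P i) * Real.sqrt (R i)) ^ 2 ≤ (∑ i, P i) * ∑ i, R i := by
    have h := sum_mul_sq_le_sq_mul_sq univ (fun i ↦ Real.sqrt (P i)) (fun i ↦ Real.sqrt (R i))
    simp only [Real.sq_sqrt (hP0 _), Real.sq_sqrt (hR0 _)] at h
    exact h
  have hlhs : ∑ b, (∑ i, ∑ a, A i b a * v i a) ^ 2 = ‖∑ i, w i‖ ^ 2 := by
    rw [EuclideanSpace.real_norm_sq_eq]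
    refine sum_congr rfl fun b _ ↦ ?_
    congr 1
    rw [WithLp.ofLp_sum, Finset.sum_apply]
  have hS0 : 0 ≤ ∑ i, Real.sqrt (P i) * Real.sqrt (R i) :=
    sum_nonneg fun i _ ↦ mul_nonneg (Real.sqrt_nonneg _) (Real.sqrt_nonneg _)
  have hsq : ‖∑ i, w i‖ ^ 2 ≤ c * ((∑ i, P i) * ∑ i, R i) := by
    have h1 : ‖∑ i, w i‖ ^ 2 ≤ (Real.sqrt c * ∑ i, Real.sqrt (P i) * Real.sqrt (R i)) ^ 2 :=
      pow_le_pow_left₀ (norm_nonneg _) hsum 2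
    rw [mul_pow, Real.sq_sqrt hc0] at h1
    exact h1.trans (mul_le_mul_of_nonneg_left hCS hc0)
  have hcd : (d : ℝ) * c = d - 1 := by
    rw [hc]
    field_simp
  rw [hlhs]
  calc (d : ℝ) * ‖∑ i, w i‖ ^ 2 ≤ (d : ℝ) * (c * ((∑ i, P i) * ∑ i, R i)) :=
        mul_le_mul_of_nonneg_left hsq hd'.le
    _ = ((d : ℝ) - 1) * (∑ i, P i) * ∑ i, R i := by rw [← mul_assoc, hcd, mul_assoc]

end KatoAlgebra

/-! ### Part B — metric contractions in an orthonormal frame of a Riemannian fibre -/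

section OrthonormalFrame

open Lorentzian Lorentzian.PseudoRiemannianMetric Bundle

variable {EB : Type*} [NormedAddCommGroup EB] [NormedSpace ℝ EB] {HB : Type*} [TopologicalSpace HB]
  {IB : ModelWithCorners ℝ EB HB} {n : ℕ∞ω} {B : Type*} [TopologicalSpace B] [ChartedSpace HB B]
  {F : Type*} [NormedAddCommGroup F] [NormedSpace ℝ F] [FiniteDimensional ℝ F]
  {V : B → Type*} [TopologicalSpace (TotalSpace F V)] [∀ b, TopologicalSpace (V b)]
  [∀ b, AddCommGroup (V b)] [∀ b, Module ℝ (V b)] [FiberBundle F V] [VectorBundle ℝ F V]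
  (g : PseudoRiemannianMetric IB n F V) (b : B)
  {ι : Type*} [Fintype ι] [DecidableEq ι] {f : Basis ι ℝ (V b)}

omit [FiniteDimensional ℝ F] [Fintype ι] in
/-- An orthonormal frame is orthogonal for `g_b`. [folklore] -/
theorem isOrthoᵢ_of_frame (hf : ∀ a c, g.val b (f a) (f c) = if a = c then 1 else 0) :
    (g.toBilinForm b).IsOrthoᵢ f := fun a c hac ↦ by
  change g.val b (f a) (f c) = 0
  rw [hf, if_neg hac]

omit [FiniteDimensional ℝ F] [Fintype ι] in
/-- The vectors of an orthonormal frame are unit, hence non-null. [folklore] -/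
theorem val_frame_self (hf : ∀ a c, g.val b (f a) (f c) = if a = c then 1 else 0) (a : ι) :
    g.val b (f a) (f a) = 1 := by
  rw [hf, if_pos rfl]

/-- **`g⁻¹(α, β) = ∑ₐ α(fₐ) β(fₐ)`** in an orthonormal frame. [cite: ONeill1983, Ch. 3, pp. 60–61] -/
theorem innerDual_eq_sum_frame (hf : ∀ a c, g.val b (f a) (f c) = if a = c then 1 else 0)
    (α β : Module.Dual ℝ (V b)) : g.innerDual b α β = ∑ a, α (f a) * β (f a) := by
  rw [g.innerDual_eq_sum_of_isOrthoᵢ b f (isOrthoᵢ_of_frame g b hf)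
    (fun a ↦ by rw [val_frame_self g b hf a]; exact one_ne_zero)]
  refine sum_congr rfl fun a _ ↦ ?_
  rw [val_frame_self g b hf a, div_one]

/-- **`|T|²_g = ∑ₐ ∑_c T(fₐ, f_c)²`** in an orthonormal frame. [cite: ONeill1983, Ch. 3, pp. 60–61] -/
theorem normSq_eq_sum_frame (hf : ∀ a c, g.val b (f a) (f c) = if a = c then 1 else 0)
    (T : LinearMap.BilinForm ℝ (V b)) : g.normSq b T = ∑ a, ∑ c, T (f a) (f c) ^ 2 := by
  rw [g.normSq_eq_sum_sq b f (isOrthoᵢ_of_frame g b hf)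
    (fun a ↦ by rw [val_frame_self g b hf a]; exact one_ne_zero), Finset.sum_comm]
  refine sum_congr rfl fun a _ ↦ sum_congr rfl fun c _ ↦ ?_
  rw [val_frame_self g b hf a, val_frame_self g b hf c, mul_one, div_one]

/-- **`tr_g T = ∑ₐ T(fₐ, fₐ)`** in an orthonormal frame. [cite: ONeill1983, Ch. 3, pp. 60–61] -/
theorem trace_eq_sum_frame (hf : ∀ a c, g.val b (f a) (f c) = if a = c then 1 else 0)
    (T : LinearMap.BilinForm ℝ (V b)) : g.trace b T = ∑ a, T (f a) (f a) := by
  rw [g.trace_eq_sum_div_of_isOrthoᵢ b f (isOrthoᵢ_of_frame g b hf)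
    (fun a ↦ by rw [val_frame_self g b hf a]; exact one_ne_zero)]
  refine sum_congr rfl fun a _ ↦ ?_
  rw [val_frame_self g b hf a, div_one]

/-- **`♯α = ∑ₐ α(fₐ) fₐ`** in an orthonormal frame. [cite: ONeill1983, Ch. 3, p. 60] -/
theorem sharp_eq_sum_frame (hf : ∀ a c, g.val b (f a) (f c) = if a = c then 1 else 0)
    (α : Module.Dual ℝ (V b)) : g.sharp b α = ∑ a, α (f a) • f a := by
  rw [g.sharp_eq_sum_of_isOrthoᵢ b f (isOrthoᵢ_of_frame g b hf)
    (fun a ↦ by rw [val_frame_self g b hf a]; exact one_ne_zero)]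
  refine sum_congr rfl fun a _ ↦ ?_
  rw [val_frame_self g b hf a, div_one]

/-- `T(w, ♯α) = ∑ₐ α(fₐ) T(w, fₐ)` in an orthonormal frame. [folklore] -/
theorem bilin_sharp_eq_sum_frame (hf : ∀ a c, g.val b (f a) (f c) = if a = c then 1 else 0)
    (T : LinearMap.BilinForm ℝ (V b)) (w : V b) (α : Module.Dual ℝ (V b)) :
    T w (g.sharp b α) = ∑ a, α (f a) * T w (f a) := by
  rw [sharp_eq_sum_frame g b hf α, map_sum]
  refine sum_congr rfl fun a _ ↦ ?_
  rw [map_smul, smul_eq_mul]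

/-- A **Riemannian** fibre has an orthonormal frame indexed by `Fin (dim)`: this is
`PseudoRiemannianMetric.exists_orthonormal_basis` (`Lorentzian/MetricDetComparison`); deprecated
restatement (dedup-01102, 2026-08-16). [folklore] -/
@[deprecated Literature.Geometry.Lorentzian.PseudoRiemannianMetric.exists_orthonormal_basis
  (since := "2026-08-16")]
theorem exists_frame (hg : g.IsRiemannian) :
    ∃ f : Basis (Fin (finrank ℝ (V b))) ℝ (V b), ∀ a c, g.val b (f a) (f c) = if a = c then 1 else 0 :=
  g.exists_orthonormal_basis b hg

end OrthonormalFrame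

/-! ### Part C — the Hessian of a finite sum; the normal Hessian of a sphere-valued map -/

section HessianCalculus

open Lorentzian Lorentzian.PseudoRiemannianMetric Bundle Filter
open scoped Manifold ContDiff Topology

variable {E : Type*} [NormedAddCommGroup E] [NormedSpace ℝ E] [FiniteDimensional ℝ E]
  {H : Type*} [TopologicalSpace H] {I : ModelWithCorners ℝ E H}
  {M : Type*} [TopologicalSpace M] [ChartedSpace H M] [IsManifold I ∞ M]
  (g : PseudoRiemannianMetric I ∞ E (TangentSpace I : M → Type _)) [g.HasLeviCivita]

omit [FiniteDimensional ℝ E] in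
/-- **The Hessian operation of a finite sum**: `H^{∑ Fᵢ}(X, Y)(x) = ∑ᵢ H^{Fᵢ}(X, Y)(x)` for `Fᵢ`
of class `C²` at `x` and `Y` differentiable at `x` (linearity of `f ↦ X(Yf) − (∇_X Y)f`).
[cite: ONeill1983, Ch. 3, Def. 3.48–Lemma 3.49] -/
theorem hessianAux_finset_sum {ι : Type*} (s : Finset ι) {F : ι → M → ℝ} {x : M}
    (hF : ∀ i ∈ s, CMDiffAt 2 (F i) x) (X : Π y : M, TangentSpace I y)
    {Y : Π y : M, TangentSpace I y} (hY : MDiffAt (T% Y) x) :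
    g.hessianAux (fun y ↦ ∑ i ∈ s, F i y) X Y x = ∑ i ∈ s, g.hessianAux (F i) X Y x := by
  classical
  -- the `Fᵢ` are differentiable near `x`
  have hev : ∀ᶠ y in 𝓝 x, ∀ i ∈ s, MDifferentiableAt I 𝓘(ℝ, ℝ) (F i) y := by
    have h : ∀ i ∈ s, ∀ᶠ y in 𝓝 x, MDifferentiableAt I 𝓘(ℝ, ℝ) (F i) y := fun i hi ↦
      ((contMDiffAt_iff_contMDiffAt_nhds (by simp)).1 (hF i hi)).mono
        fun y hy ↦ hy.mdifferentiableAt (by norm_num)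
    exact (Filter.eventually_all_finset s).2 h
  have heq : (fun y ↦ mvfderiv I (fun z ↦ ∑ i ∈ s, F i z) y (Y y)) =ᶠ[𝓝 x]
      fun y ↦ ∑ i ∈ s, mvfderiv I (F i) y (Y y) := by
    filter_upwards [hev] with y hy
    rw [(mvfderiv_finset_sum s hy).2, FunLike.coe_sum, Finset.sum_apply]
  have hdi : ∀ i ∈ s, MDifferentiableAt I 𝓘(ℝ, ℝ) (fun y ↦ mvfderiv I (F i) y (Y y)) x :=
    fun i hi ↦ mdifferentiableAt_mvfderiv_apply (hF i hi) hY
  have h1 : mvfderiv I (fun y ↦ mvfderiv I (fun z ↦ ∑ i ∈ s, F i z) y (Y y)) x (X x) =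
      ∑ i ∈ s, mvfderiv I (fun y ↦ mvfderiv I (F i) y (Y y)) x (X x) := by
    rw [mvfderiv_congr_of_eventuallyEq heq, (mvfderiv_finset_sum s hdi).2,
      FunLike.coe_sum, Finset.sum_apply]
  have hFx : ∀ i ∈ s, MDifferentiableAt I 𝓘(ℝ, ℝ) (F i) x := fun i hi ↦
    (hF i hi).mdifferentiableAt (by norm_num)
  have h2 : mvfderiv I (fun z ↦ ∑ i ∈ s, F i z) x (g.leviCivita Y x (X x)) =
      ∑ i ∈ s, mvfderiv I (F i) x (g.leviCivita Y x (X x)) := by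
    rw [(mvfderiv_finset_sum s hFx).2, FunLike.coe_sum, Finset.sum_apply]
  simp only [hessianAux]
  rw [h1, h2, ← Finset.sum_sub_distrib]

/-- **The Hessian of a finite sum**: `Hess(∑ᵢ Fᵢ)_x = ∑ᵢ Hess(Fᵢ)_x` for `Fᵢ` of class `C²` at
`x` (both sides evaluate classically on extended vectors, `hessian_apply_holds`).
[cite: ONeill1983, Ch. 3, Def. 3.48–Lemma 3.49] -/
theorem hessian_finset_sum {ι : Type*} (s : Finset ι) {F : ι → M → ℝ} {x : M}
    (hF : ∀ i ∈ s, CMDiffAt 2 (F i) x) (v w : TangentSpace I x) :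
    g.hessian (fun y ↦ ∑ i ∈ s, F i y) x v w = ∑ i ∈ s, g.hessian (F i) x v w := by
  classical
  have hsum : CMDiffAt 2 (fun y ↦ ∑ i ∈ s, F i y) x := contMDiffAt_finsetSum hF
  set X : Π y : M, TangentSpace I y := FiberBundle.extend E v with hX
  set Y : Π y : M, TangentSpace I y := FiberBundle.extend E w with hY
  have hXd : MDiffAt (T% X) x := FiberBundle.mdifferentiableAt_extend ..
  have hYd : MDiffAt (T% Y) x := FiberBundle.mdifferentiableAt_extend ..
  have hv : X x = v := by rw [hX, FiberBundle.extend_apply_self]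
  have hw : Y x = w := by rw [hY, FiberBundle.extend_apply_self]
  rw [← hv, ← hw, g.hessian_apply_holds hsum hXd hYd, hessianAux_finset_sum g s hF X hYd]
  refine Finset.sum_congr rfl fun i hi ↦ ?_
  rw [g.hessian_apply_holds (hF i hi) hXd hYd]

/-- `Hess(f²)_x(v, w) = 2 df(v) df(w) + 2 f(x) Hess f_x(v, w)` (`hessian_real_comp` with
`ζ = t²`). [cite: ONeill1983, Ch. 3, Lemma 3.49] -/
theorem hessian_sq {f : M → ℝ} {x : M} (hf : CMDiffAt 2 f x) (v w : TangentSpace I x) :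
    g.hessian (fun y ↦ f y ^ 2) x v w =
      2 * (mvfderiv I f x v * mvfderiv I f x w) + 2 * f x * g.hessian f x v w := by
  have hζ : ContDiffAt ℝ 2 (fun t : ℝ ↦ t ^ 2) (f x) := (contDiff_id.pow 2).contDiffAt
  have h := g.hessian_real_comp (ζ := fun t : ℝ ↦ t ^ 2) hf hζ v w
  have h1 : deriv (fun t : ℝ ↦ t ^ 2) = fun t ↦ 2 * t := by
    funext t
    simp
  have h2 : deriv (deriv fun t : ℝ ↦ t ^ 2) (f x) = 2 := by
    rw [h1]
    simp
  have h3 : deriv (fun t : ℝ ↦ t ^ 2) (f x) = 2 * f x := by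
    rw [h1]
  have hcomp : ((fun t : ℝ ↦ t ^ 2) ∘ f) = fun y ↦ f y ^ 2 := rfl
  rw [hcomp] at h
  rw [h, h2, h3]

variable {k : ℕ}

/-- **The normal Hessian of a sphere-valued map**: for a `C²` map `u : M → Sᵏ ⊂ ℝᵏ⁺¹` with
coordinates `uᵢ`, `∑ᵢ uᵢ Hess(uᵢ)_x(v, w) = −∑ᵢ duᵢ(v) duᵢ(w)` (apply `Hess` to `∑ᵢ uᵢ² = 1`).
This is the decomposition `Hess(u) = Hess(u)ᵀ − u ⊗ du*du` of Karpukhin–Stern p. 748.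
[cite: KarpukhinStern2024, §3.1 p. 748] -/
theorem sum_sphereCoord_mul_hessian
    {u : M → Metric.sphere (0 : EuclideanSpace ℝ (Fin (k + 1))) 1} {x : M}
    (hu : ∀ i, CMDiffAt 2 (fun y ↦ (u y : EuclideanSpace ℝ (Fin (k + 1))) i) x)
    (v w : TangentSpace I x) :
    ∑ i, (u x : EuclideanSpace ℝ (Fin (k + 1))) i *
        g.hessian (fun y ↦ (u y : EuclideanSpace ℝ (Fin (k + 1))) i) x v w =
      -∑ i, mvfderiv I (fun y ↦ (u y : EuclideanSpace ℝ (Fin (k + 1))) i) x v *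
        mvfderiv I (fun y ↦ (u y : EuclideanSpace ℝ (Fin (k + 1))) i) x w := by
  -- `Hess(∑ uᵢ²) = Hess(1) = 0`
  have hsq : ∀ i, CMDiffAt 2 (fun y ↦ (u y : EuclideanSpace ℝ (Fin (k + 1))) i ^ 2) x :=
    fun i ↦ (hu i).pow 2
  have hone : (fun y ↦ ∑ i, (u y : EuclideanSpace ℝ (Fin (k + 1))) i ^ 2) = fun _ ↦ (1 : ℝ) := by
    funext y
    exact sum_sphereCoord_sq (u y)
  have h0 : g.hessian (fun y ↦ ∑ i, (u y : EuclideanSpace ℝ (Fin (k + 1))) i ^ 2) x v w = 0 := by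
    rw [hone]
    have hc : CMDiffAt 2 (fun _ : M ↦ (1 : ℝ)) x := contMDiffAt_const
    have h := g.hessian_real_comp (u := fun _ : M ↦ (1 : ℝ)) (ζ := fun _ : ℝ ↦ (1 : ℝ)) hc
      contDiffAt_const v w
    have hcomp : ((fun _ : ℝ ↦ (1 : ℝ)) ∘ fun _ : M ↦ (1 : ℝ)) = fun _ : M ↦ (1 : ℝ) := rfl
    rw [hcomp] at h
    rw [h]
    simp
  rw [hessian_finset_sum g Finset.univ (fun i _ ↦ hsq i)] at h0
  simp_rw [hessian_sq g (hu _)] at h0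
  rw [Finset.sum_add_distrib, ← Finset.mul_sum] at h0
  have h2 : ∑ i, 2 * (u x : EuclideanSpace ℝ (Fin (k + 1))) i *
        g.hessian (fun y ↦ (u y : EuclideanSpace ℝ (Fin (k + 1))) i) x v w =
      2 * ∑ i, (u x : EuclideanSpace ℝ (Fin (k + 1))) i *
        g.hessian (fun y ↦ (u y : EuclideanSpace ℝ (Fin (k + 1))) i) x v w := by
    rw [Finset.mul_sum]
    refine Finset.sum_congr rfl fun i _ ↦ ?_
    ring
  rw [h2] at h0
  linarith

end HessianCalculus

/-! ### Part D — the Bochner identity for sphere-valued harmonic maps and Karpukhin–Stern's (3.3) -/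

section Bochner

open Lorentzian Lorentzian.PseudoRiemannianMetric Bundle Filter

variable {m : ℕ} {H' : Type*} [TopologicalSpace H']
  {J : ModelWithCorners ℝ (EuclideanSpace ℝ (Fin m)) H'} [J.Boundaryless]
  {N : Type*} [TopologicalSpace N] [ChartedSpace H' N] [IsManifold J ∞ N]
  (h : ContMDiffRiemannianMetric J ∞ (EuclideanSpace ℝ (Fin m)) (TangentSpace J : N → Type _))
  {k : ℕ}

omit [J.Boundaryless] in
/-- `|du|²_h = ∑ᵢ |∇uᵢ|²_h` (`energyDensity` versus `gradSq`, definitional). [cite: KarpukhinStern2024, Thm. 1.5 p. 719] -/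
theorem energyDensity_eq_sum_gradSq (u : N → Metric.sphere (0 : EuclideanSpace ℝ (Fin (k + 1))) 1)
    (x : N) : energyDensity h u x =
      ∑ i, (ofRiemannian h).gradSq (fun y ↦ (u y : EuclideanSpace ℝ (Fin (k + 1))) i) x :=
  rfl

/-- The energy density of a smooth sphere-valued map is smooth. [folklore] -/
theorem contMDiff_energyDensity {u : N → Metric.sphere (0 : EuclideanSpace ℝ (Fin (k + 1))) 1}
    (hu : ContMDiff J (𝓡 k) ∞ u) : ContMDiff J 𝓘(ℝ, ℝ) ∞ (energyDensity h u) := by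
  have hfun : energyDensity h u =
      fun x ↦ ∑ i, (ofRiemannian h).gradSq (fun y ↦ (u y : EuclideanSpace ℝ (Fin (k + 1))) i) x :=
    rfl
  rw [hfun]
  exact contMDiff_finsetSum fun i _ ↦ contMDiff_gradSq (ofRiemannian h) (contMDiff_sphereCoord hu i)

omit [J.Boundaryless] in
/-- `g⁻¹(α, L)` is linear in the continuous covector `L` through the coercion to `Module.Dual`:
`g⁻¹(α, −(a L₁ + b L₂)) = −(a g⁻¹(α, L₁) + b g⁻¹(α, L₂))`. [folklore] -/
theorem innerDual_neg_add_smul (x : N) (α : Module.Dual ℝ (TangentSpace J x))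
    (a b : ℝ) (L₁ L₂ : TangentSpace J x →L[ℝ] ℝ) :
    (ofRiemannian h).innerDual x α ((-(a • L₁ + b • L₂) : TangentSpace J x →L[ℝ] ℝ) :
        TangentSpace J x →ₗ[ℝ] ℝ) =
      -(a * (ofRiemannian h).innerDual x α (L₁ : TangentSpace J x →ₗ[ℝ] ℝ) +
        b * (ofRiemannian h).innerDual x α (L₂ : TangentSpace J x →ₗ[ℝ] ℝ)) := by
  simp only [innerDual, ContinuousLinearMap.toLinearMap_neg, ContinuousLinearMap.toLinearMap_add,
    ContinuousLinearMap.toLinearMap_smul, map_neg, map_add, map_smul, smul_eq_mul]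

variable [(ofRiemannian h).HasLeviCivita]

/-- **The Bochner identity for a sphere-valued harmonic map** (Karpukhin–Stern p. 747:
"`−½ Δ|du|² = |Hess(u)|² + ⟨Ric_M, du*du⟩ − |du|⁴`", `Δ = −tr Hess`): for a smooth
`u : N → Sᵏ ⊂ ℝᵏ⁺¹` solving the harmonic-map equation `tr_h Hess uᵢ = −|du|²_h uᵢ`,

  `tr_h Hess (|du|²_h) = 2 ∑ᵢ |Hess uᵢ|²_h + 2 ∑ᵢ Ric(∇uᵢ, ∇uᵢ) − 2 |du|⁴_h`.

Proof: sum the Bochner formula `dalembertian_gradSq_eq` over the coordinates; the middle terms give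
`∑ᵢ h⁻¹(duᵢ, d(−|du|² uᵢ)) = −|du|⁴ − h⁻¹(∑ᵢ uᵢ duᵢ, d|du|²) = −|du|⁴` (`∑ᵢ uᵢ duᵢ = 0`).
[cite: KarpukhinStern2024, §3.1 p. 747 (Bochner identity)] -/
theorem dalembertian_energyDensity_eq
    {u : N → Metric.sphere (0 : EuclideanSpace ℝ (Fin (k + 1))) 1} (hu : ContMDiff J (𝓡 k) ∞ u)
    (harm : ∀ (i : Fin (k + 1)) (x : N), (ofRiemannian h).dalembertian
      (fun y ↦ (u y : EuclideanSpace ℝ (Fin (k + 1))) i) x =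
        -(energyDensity h u x) * (u x : EuclideanSpace ℝ (Fin (k + 1))) i) (x : N) :
    (ofRiemannian h).dalembertian (energyDensity h u) x =
      2 * ∑ i, (ofRiemannian h).normSq x
          ((ofRiemannian h).hessian (fun y ↦ (u y : EuclideanSpace ℝ (Fin (k + 1))) i) x)
        + 2 * ∑ i, (ofRiemannian h).ricci x
          ((ofRiemannian h).sharp x (mvfderiv J (fun y ↦ (u y : EuclideanSpace ℝ (Fin (k + 1))) i) x :
            TangentSpace J x →ₗ[ℝ] ℝ))
          ((ofRiemannian h).sharp x (mvfderiv J (fun y ↦ (u y : EuclideanSpace ℝ (Fin (k + 1))) i) x :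
            TangentSpace J x →ₗ[ℝ] ℝ))
        - 2 * energyDensity h u x ^ 2 := by
  set g := ofRiemannian h with hg
  set U : Fin (k + 1) → N → ℝ := fun i y ↦ (u y : EuclideanSpace ℝ (Fin (k + 1))) i with hUdef
  have hU : ∀ i, ContMDiff J 𝓘(ℝ, ℝ) ∞ (U i) := contMDiff_sphereCoord hu
  have he : ContMDiff J 𝓘(ℝ, ℝ) ∞ (energyDensity h u) := contMDiff_energyDensity h hu
  have hed : MDifferentiableAt J 𝓘(ℝ, ℝ) (energyDensity h u) x := he.mdifferentiableAt (by simp) 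
  have hUd : ∀ i, MDifferentiableAt J 𝓘(ℝ, ℝ) (U i) x := fun i ↦ (hU i).mdifferentiableAt (by simp)
  -- `□e = ∑ᵢ □|∇uᵢ|²`
  have h1 : g.dalembertian (energyDensity h u) x = ∑ i, g.dalembertian (g.gradSq (U i)) x := by
    have hfun : energyDensity h u = fun y ↦ ∑ i, g.gradSq (U i) y := rfl
    rw [hfun]
    exact dalembertian_finset_sum g Finset.univ fun i _ ↦
      ((contMDiff_gradSq g (hU i)).of_le (WithTop.coe_le_coe.mpr le_top)).contMDiffAt
  -- `d(□uᵢ) = −(e duᵢ + uᵢ de)`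
  have h3 : ∀ i, mvfderiv J (g.dalembertian (U i)) x =
      -((energyDensity h u x) • mvfderiv J (U i) x + (U i x) • mvfderiv J (energyDensity h u) x) := by
    intro i
    have hLap : g.dalembertian (U i) = fun y ↦ -((energyDensity h u y) * U i y) := by
      funext y
      rw [harm i y]
      ring
    rw [hLap, mvfderiv_fun_neg, mvfderiv_fun_mul hed (hUd i)]
  -- the middle terms
  have h4 : ∑ i, g.innerDual x (mvfderiv J (U i) x : TangentSpace J x →ₗ[ℝ] ℝ)
      (mvfderiv J (g.dalembertian (U i)) x : TangentSpace J x →ₗ[ℝ] ℝ) =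
      -(energyDensity h u x) ^ 2 := by
    have hterm : ∀ i, g.innerDual x (mvfderiv J (U i) x : TangentSpace J x →ₗ[ℝ] ℝ)
        (mvfderiv J (g.dalembertian (U i)) x : TangentSpace J x →ₗ[ℝ] ℝ) =
        -((energyDensity h u x) * g.innerDual x (mvfderiv J (U i) x : TangentSpace J x →ₗ[ℝ] ℝ)
            (mvfderiv J (U i) x : TangentSpace J x →ₗ[ℝ] ℝ) +
          U i x * g.innerDual x (mvfderiv J (U i) x : TangentSpace J x →ₗ[ℝ] ℝ)
            (mvfderiv J (energyDensity h u) x : TangentSpace J x →ₗ[ℝ] ℝ)) := by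
      intro i
      rw [h3 i]
      exact innerDual_neg_add_smul h x _ _ _ _ _
    simp_rw [hterm]
    rw [Finset.sum_neg_distrib, Finset.sum_add_distrib, ← Finset.mul_sum]
    -- `∑ᵢ uᵢ h⁻¹(duᵢ, de) = de(♯ ∑ uᵢ duᵢ)`-type cancellation
    have hzero : ∑ i, U i x * g.innerDual x (mvfderiv J (U i) x : TangentSpace J x →ₗ[ℝ] ℝ)
        (mvfderiv J (energyDensity h u) x : TangentSpace J x →ₗ[ℝ] ℝ) = 0 := by
      have h0 := sum_sphereCoord_smul_mvfderiv hu x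
      have h0' := congrArg (fun L : TangentSpace J x →L[ℝ] ℝ ↦
        L (g.sharp x (mvfderiv J (energyDensity h u) x : TangentSpace J x →ₗ[ℝ] ℝ))) h0
      simp only [FunLike.coe_sum, Finset.sum_apply, FunLike.coe_smul, Pi.smul_apply,
        smul_eq_mul, zero_apply] at h0'
      simpa [innerDual] using h0'
    rw [hzero, add_zero]
    have hee : ∑ i, g.innerDual x (mvfderiv J (U i) x : TangentSpace J x →ₗ[ℝ] ℝ)
        (mvfderiv J (U i) x : TangentSpace J x →ₗ[ℝ] ℝ) = energyDensity h u x := rfl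
    rw [hee]
    ring
  -- assemble
  have h2 : ∀ i, g.dalembertian (g.gradSq (U i)) x =
      2 * g.normSq x (g.hessian (U i) x)
        + 2 * g.innerDual x (mvfderiv J (U i) x : TangentSpace J x →ₗ[ℝ] ℝ)
            (mvfderiv J (g.dalembertian (U i)) x : TangentSpace J x →ₗ[ℝ] ℝ)
        + 2 * g.ricci x (g.sharp x (mvfderiv J (U i) x : TangentSpace J x →ₗ[ℝ] ℝ))
            (g.sharp x (mvfderiv J (U i) x : TangentSpace J x →ₗ[ℝ] ℝ)) :=
    fun i ↦ dalembertian_gradSq_eq g (hU i) x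
  rw [h1]
  simp_rw [h2]
  rw [Finset.sum_add_distrib, Finset.sum_add_distrib, ← Finset.mul_sum, ← Finset.mul_sum,
    ← Finset.mul_sum, h4]
  ring

/-- `(∑ₐ B_{aa})² ≤ d ∑_{ab} B_{ab}²` for a real `d × d` matrix (Cauchy–Schwarz on the diagonal).
Karpukhin–Stern p. 748: "`∑ᵢⱼ ⟨du(eᵢ), du(eⱼ)⟩² ⩾ (1/n)|du|⁴`". [cite: KarpukhinStern2024, §3.1 p. 748] -/
theorem sq_trace_le_card_mul_sum_sq {d : ℕ} (B : Fin d → Fin d → ℝ) :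
    (∑ a, B a a) ^ 2 ≤ (d : ℝ) * ∑ a, ∑ b, B a b ^ 2 := by
  have h1 : (∑ a, B a a) ^ 2 ≤ (Finset.univ : Finset (Fin d)).card * ∑ a, B a a ^ 2 :=
    sq_sum_le_card_mul_sum_sq
  rw [Finset.card_univ, Fintype.card_fin] at h1
  refine h1.trans (mul_le_mul_of_nonneg_left (Finset.sum_le_sum fun a _ ↦ ?_) (Nat.cast_nonneg d))
  exact Finset.single_le_sum (f := fun b ↦ B a b ^ 2) (fun b _ ↦ sq_nonneg _) (Finset.mem_univ a)

/-- **Karpukhin–Stern's inequality (3.3), multiplied by `|du|²`.** Let `u : N → Sᵏ` be a smooth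
harmonic map (`tr_h Hess uᵢ = −|du|²_h uᵢ`) on a Riemannian manifold of dimension `m` with
`Ric ≥ −K h`, and put `e = |du|²_h`, `R = tr_h Hess e + 2K e + (2 − 2/m) e²`. Then at every point

  `0 ≤ R` and `m · h⁻¹(de, de) ≤ 2 (m − 1) · e · R`.

Where `e > 0` this is (3.3) of the paper,
`−½ Δ|du|² ≥ (n/(n−1)) |d|du||² − ‖Ric⁻‖ |du|² − ((n−1)/n) |du|⁴` (`Δ = −tr Hess`,
`|d|du||² = |de|²/(4e)`), obtained exactly as printed: the Bochner identity
(`dalembertian_energyDensity_eq`), the decomposition `Hess(u) = Hess(u)ᵀ − u ⊗ du*du`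
(`sum_sphereCoord_mul_hessian`; in an orthonormal frame `Aⁱ = Hess uᵢ + uᵢ B`,
`B_{ab} = ∑ⱼ duⱼ(f_a) duⱼ(f_b)`, so that `∑ᵢ |Hess uᵢ|² = ∑ᵢ |Aⁱ|² + |B|²`), the estimate
`|B|² = ∑ ⟨du(eₐ), du(e_b)⟩² ≥ |du|⁴/n` (`sq_trace_le_card_mul_sum_sq`), and the refined Kato
inequality `|Hess(u)ᵀ|² ≥ (n/(n−1)) |d|du||²` of [38, Prop. 2.3] — here
`traceless_symm_sum_mulVec_sq_le`, the `Aⁱ` being symmetric and traceless BY the harmonic-map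
equation (`tr Aⁱ = tr Hess uᵢ + uᵢ |du|² = 0`) and `de(f_b) = 2 ∑ᵢₐ Aⁱ_{ba} duᵢ(f_a)`
(`∑ᵢ uᵢ duᵢ = 0`). The multiplied form needs no division and holds also where `du = 0`.
[cite: KarpukhinStern2024, (3.3) p. 748] -/
theorem kato_bochner_energyDensity
    {u : N → Metric.sphere (0 : EuclideanSpace ℝ (Fin (k + 1))) 1} (hu : ContMDiff J (𝓡 k) ∞ u)
    (harm : ∀ (i : Fin (k + 1)) (x : N), (ofRiemannian h).dalembertian
      (fun y ↦ (u y : EuclideanSpace ℝ (Fin (k + 1))) i) x =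
        -(energyDensity h u x) * (u x : EuclideanSpace ℝ (Fin (k + 1))) i)
    {K : ℝ} (hK : ∀ (x : N) (v : TangentSpace J x),
      -(K * (ofRiemannian h).val x v v) ≤ (ofRiemannian h).ricci x v v) (x : N) :
    0 ≤ (ofRiemannian h).dalembertian (energyDensity h u) x + 2 * K * energyDensity h u x
        + (2 - 2 / m) * energyDensity h u x ^ 2 ∧
      (m : ℝ) * (ofRiemannian h).gradSq (energyDensity h u) x ≤
        2 * ((m : ℝ) - 1) * energyDensity h u x *
          ((ofRiemannian h).dalembertian (energyDensity h u) x + 2 * K * energyDensity h u x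
            + (2 - 2 / m) * energyDensity h u x ^ 2) := by
  classical
  set g := ofRiemannian h with hg
  set U : Fin (k + 1) → N → ℝ := fun i y ↦ (u y : EuclideanSpace ℝ (Fin (k + 1))) i with hUdef
  have hU : ∀ i, ContMDiff J 𝓘(ℝ, ℝ) ∞ (U i) := contMDiff_sphereCoord hu
  have hU2 : ∀ i, CMDiffAt 2 (U i) x := fun i ↦
    ((hU i).of_le (WithTop.coe_le_coe.mpr le_top)).contMDiffAt
  have hgR : g.IsRiemannian := isRiemannian_ofRiemannian h
  -- an orthonormal frame at `x`, indexed by `Fin m`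
  have hdim : finrank ℝ (TangentSpace J x) = m := finrank_euclideanSpace_fin
  obtain ⟨f₀, hf₀⟩ := g.exists_orthonormal_basis x hgR
  set f : Basis (Fin m) ℝ (TangentSpace J x) := f₀.reindex (finCongr hdim) with hfdef
  have hf : ∀ a c, g.val x (f a) (f c) = if a = c then 1 else 0 := by
    intro a c
    rw [hfdef, Basis.reindex_apply, Basis.reindex_apply, hf₀]
    simp only [finCongr_symm, finCongr_apply, Fin.cast_inj]
  -- the matrices of the printed proof
  set e : ℝ := energyDensity h u x with hedef
  set Hm : Fin (k + 1) → Fin m → Fin m → ℝ := fun i a b ↦ g.hessian (U i) x (f a) (f b) with hHm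
  set V : Fin (k + 1) → Fin m → ℝ := fun i a ↦ mvfderiv J (U i) x (f a) with hV
  set Bm : Fin m → Fin m → ℝ := fun a b ↦ ∑ j, V j a * V j b with hBm
  set Am : Fin (k + 1) → Fin m → Fin m → ℝ := fun i a b ↦ Hm i a b + U i x * Bm a b with hAm
  -- (a) `|Hess uᵢ|² = ∑ Hm²`
  have ha : ∀ i, g.normSq x (g.hessian (U i) x) = ∑ a, ∑ b, Hm i a b ^ 2 := fun i ↦
    normSq_eq_sum_frame g x hf _
  -- (b) `e = ∑ⱼₐ Vⱼₐ²`
  have hb : e = ∑ j, ∑ a, V j a ^ 2 := by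
    rw [hedef]
    change ∑ j, g.innerDual x _ _ = _
    refine Finset.sum_congr rfl fun j _ ↦ ?_
    rw [innerDual_eq_sum_frame g x hf]
    refine Finset.sum_congr rfl fun a _ ↦ ?_
    rw [hV, sq]
    rfl
  have hBdiag : ∑ a, Bm a a = e := by
    rw [hb, Finset.sum_comm]
    refine Finset.sum_congr rfl fun a _ ↦ Finset.sum_congr rfl fun j _ ↦ ?_
    ring
  -- (c) `tr Hess uᵢ = −e uᵢ`
  have hc : ∀ i, ∑ a, Hm i a a = -e * U i x := by
    intro i
    have h1 : g.trace x (g.hessian (U i) x) = ∑ a, Hm i a a := trace_eq_sum_frame g x hf _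
    rw [← h1]
    exact harm i x
  -- (d) `∑ᵢ uᵢ Hmᵢ = −B`
  have hdd : ∀ a b, ∑ i, U i x * Hm i a b = -Bm a b := fun a b ↦
    sum_sphereCoord_mul_hessian g hU2 (f a) (f b)
  -- (e) `∑ᵢ uᵢ Vᵢₐ = 0`, `∑ uᵢ² = 1`
  have he0 : ∀ a, ∑ i, U i x * V i a = 0 := by
    intro a
    have h0 := congrArg (fun L : TangentSpace J x →L[ℝ] ℝ ↦ L (f a)) (sum_sphereCoord_smul_mvfderiv hu x)
    simp only [FunLike.coe_sum, Finset.sum_apply, FunLike.coe_smul, Pi.smul_apply, smul_eq_mul,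
      zero_apply] at h0
    exact h0
  have hone : ∑ i, U i x ^ 2 = 1 := sum_sphereCoord_sq (u x)
  -- (f) symmetry
  have hHsymm : ∀ i a b, Hm i a b = Hm i b a := fun i a b ↦
    (g.hessian_symm_holds (hU2 i)).eq (f a) (f b)
  have hBsymm : ∀ a b, Bm a b = Bm b a := fun a b ↦
    Finset.sum_congr rfl fun j _ ↦ mul_comm _ _
  have hAsymm : ∀ i a b, Am i a b = Am i b a := by
    intro i a b
    simp only [hAm, hHsymm i a b, hBsymm a b]
  -- (g) `de(f_b) = 2 ∑ⱼₐ Vⱼₐ Hmⱼ_{ba}`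
  have hde : ∀ b, mvfderiv J (energyDensity h u) x (f b) = 2 * ∑ j, ∑ a, V j a * Hm j b a := by
    intro b
    have hdiff : ∀ j ∈ (Finset.univ : Finset (Fin (k + 1))),
        MDifferentiableAt J 𝓘(ℝ, ℝ) (g.gradSq (U j)) x := fun j _ ↦
      (contMDiff_gradSq g (hU j)).mdifferentiableAt (by simp)
    have hfun : energyDensity h u = fun y ↦ ∑ j, g.gradSq (U j) y := rfl
    rw [hfun, (mvfderiv_finset_sum Finset.univ hdiff).2, FunLike.coe_sum, Finset.sum_apply,
      Finset.mul_sum]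
    refine Finset.sum_congr rfl fun j _ ↦ ?_
    rw [mvfderiv_gradSq_apply g (hU j) x (f b), bilin_sharp_eq_sum_frame g x hf, Finset.mul_sum,
      Finset.mul_sum]
    refine Finset.sum_congr rfl fun a _ ↦ ?_
    simp only [hV, hHm]
    rfl
  -- (h) `|de|² = ∑_b de(f_b)²`
  have hh : g.gradSq (energyDensity h u) x = ∑ b, (mvfderiv J (energyDensity h u) x (f b)) ^ 2 := by
    simp only [PseudoRiemannianMetric.gradSq]
    rw [innerDual_eq_sum_frame g x hf]
    refine Finset.sum_congr rfl fun b _ ↦ ?_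
    rw [sq]
    rfl
  -- (i) Ricci
  have hi : -(K * e) ≤ ∑ i, g.ricci x (g.sharp x (mvfderiv J (U i) x : TangentSpace J x →ₗ[ℝ] ℝ))
      (g.sharp x (mvfderiv J (U i) x : TangentSpace J x →ₗ[ℝ] ℝ)) := by
    have h1 : ∀ i, -(K * g.innerDual x (mvfderiv J (U i) x : TangentSpace J x →ₗ[ℝ] ℝ)
        (mvfderiv J (U i) x : TangentSpace J x →ₗ[ℝ] ℝ)) ≤
        g.ricci x (g.sharp x (mvfderiv J (U i) x : TangentSpace J x →ₗ[ℝ] ℝ))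
          (g.sharp x (mvfderiv J (U i) x : TangentSpace J x →ₗ[ℝ] ℝ)) := by
      intro i
      rw [innerDual_eq_val_sharp_sharp]
      exact hK x _
    have h2 := Finset.sum_le_sum fun i (_ : i ∈ Finset.univ) ↦ h1 i
    rw [Finset.sum_neg_distrib, ← Finset.mul_sum] at h2
    exact h2
  -- (A) `∑ |Aⁱ|² = ∑ |Hess uᵢ|² − |B|²`
  have hA : ∑ i, ∑ a, ∑ b, Am i a b ^ 2 = (∑ i, ∑ a, ∑ b, Hm i a b ^ 2) - ∑ a, ∑ b, Bm a b ^ 2 := by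
    have hswap : ∀ X : Fin (k + 1) → Fin m → Fin m → ℝ,
        ∑ i, ∑ a, ∑ b, X i a b = ∑ a, ∑ b, ∑ i, X i a b := by
      intro X
      rw [Finset.sum_comm]
      exact Finset.sum_congr rfl fun a _ ↦ Finset.sum_comm
    rw [hswap, hswap, ← Finset.sum_sub_distrib]
    refine Finset.sum_congr rfl fun a _ ↦ ?_
    rw [← Finset.sum_sub_distrib]
    refine Finset.sum_congr rfl fun b _ ↦ ?_
    have hexp : ∀ i, Am i a b ^ 2 =
        Hm i a b ^ 2 + 2 * Bm a b * (U i x * Hm i a b) + Bm a b ^ 2 * U i x ^ 2 := by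
      intro i
      simp only [hAm]
      ring
    simp_rw [hexp]
    rw [Finset.sum_add_distrib, Finset.sum_add_distrib, ← Finset.mul_sum, ← Finset.mul_sum, hdd,
      hone]
    ring
  -- (B) `tr Aⁱ = 0`
  have hB : ∀ i, ∑ a, Am i a a = 0 := by
    intro i
    simp only [hAm]
    rw [Finset.sum_add_distrib, ← Finset.mul_sum, hc i, hBdiag]
    ring
  -- (C) `∑ᵢₐ Aⁱ_{ba} Vᵢₐ = ∑ᵢₐ Hmⁱ_{ba} Vᵢₐ`
  have hC : ∀ b, ∑ i, ∑ a, Am i b a * V i a = ∑ i, ∑ a, Hm i b a * V i a := by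
    intro b
    have h1 : ∀ i, ∑ a, Am i b a * V i a = ∑ a, Hm i b a * V i a + ∑ a, Bm b a * (U i x * V i a) := by
      intro i
      rw [← Finset.sum_add_distrib]
      refine Finset.sum_congr rfl fun a _ ↦ ?_
      simp only [hAm]
      ring
    simp_rw [h1]
    rw [Finset.sum_add_distrib]
    have h2 : ∑ i, ∑ a, Bm b a * (U i x * V i a) = 0 := by
      rw [Finset.sum_comm]
      refine Finset.sum_eq_zero fun a _ ↦ ?_
      rw [← Finset.mul_sum, he0 a, mul_zero]
    rw [h2, add_zero]
  -- (D) the refined Kato inequality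
  have hD := traceless_symm_sum_mulVec_sq_le Am hAsymm hB V
  have hD1 : ∑ b, (∑ i, ∑ a, Am i b a * V i a) ^ 2 = g.gradSq (energyDensity h u) x / 4 := by
    rw [hh, Finset.sum_div]
    refine Finset.sum_congr rfl fun b _ ↦ ?_
    rw [hC b, hde b]
    have : ∑ j, ∑ a, V j a * Hm j b a = ∑ i, ∑ a, Hm i b a * V i a :=
      Finset.sum_congr rfl fun i _ ↦ Finset.sum_congr rfl fun a _ ↦ mul_comm _ _
    rw [this]
    ring
  have hD2 : ∑ i, ∑ a, ∑ b, Am i b a ^ 2 = ∑ i, ∑ a, ∑ b, Am i a b ^ 2 :=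
    Finset.sum_congr rfl fun i _ ↦ Finset.sum_comm
  rw [hD1, hD2, ← hb] at hD
  -- (E) `e² ≤ m |B|²`
  have hE : e ^ 2 ≤ (m : ℝ) * ∑ a, ∑ b, Bm a b ^ 2 := by
    rw [← hBdiag]
    exact sq_trace_le_card_mul_sum_sq Bm
  -- (F) the Bochner identity
  have hF := dalembertian_energyDensity_eq h hu harm x
  obtain ⟨S, hS⟩ : ∃ S : ℝ, S = ∑ i, ∑ a, ∑ b, Am i a b ^ 2 := ⟨_, rfl⟩
  obtain ⟨P, hP⟩ : ∃ P : ℝ, P = ∑ a, ∑ b, Bm a b ^ 2 := ⟨_, rfl⟩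
  rw [← hS, ← hP] at hA
  rw [← hS] at hD
  rw [← hP] at hE
  have hS0 : 0 ≤ S := hS ▸ Finset.sum_nonneg fun i _ ↦ Finset.sum_nonneg fun a _ ↦
    Finset.sum_nonneg fun b _ ↦ sq_nonneg _
  have hP0 : 0 ≤ P := hP ▸ Finset.sum_nonneg fun a _ ↦ Finset.sum_nonneg fun b _ ↦ sq_nonneg _
  have he0' : 0 ≤ e := energyDensity_nonneg' h u x
  have hnormSq : ∑ i, g.normSq x (g.hessian (U i) x) = S + P := by
    simp_rw [ha]
    linarith
  -- `R ≥ 2S`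
  obtain ⟨R, hR⟩ : ∃ R : ℝ,
      R = g.dalembertian (energyDensity h u) x + 2 * K * e + (2 - 2 / m) * e ^ 2 := ⟨_, rfl⟩
  have hPm : 2 / (m : ℝ) * e ^ 2 ≤ 2 * P := by
    rcases Nat.eq_zero_or_pos m with hm | hm
    · rw [hm]
      simp only [Nat.cast_zero, div_zero, zero_mul]
      linarith
    · have hm' : (0 : ℝ) < m := by exact_mod_cast hm
      rw [div_mul_eq_mul_div, div_le_iff₀ hm']
      nlinarith
  have hRS : 2 * S ≤ R := by
    have h1 : g.dalembertian (energyDensity h u) x = 2 * (S + P) + 2 * ∑ i, g.ricci x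
        (g.sharp x (mvfderiv J (U i) x : TangentSpace J x →ₗ[ℝ] ℝ))
        (g.sharp x (mvfderiv J (U i) x : TangentSpace J x →ₗ[ℝ] ℝ)) - 2 * e ^ 2 := by
      rw [hF, hnormSq]
    rw [hR, h1]
    nlinarith
  rw [← hR]
  refine ⟨by linarith, ?_⟩
  -- (G) `m |de|² ≤ 4 (m−1) S e ≤ 2 (m−1) e R`
  rcases Nat.eq_zero_or_pos m with hm | hm
  · -- zero-dimensional: `e = 0`
    have he00 : e = 0 := by
      rw [hb]
      subst hm
      simp
    subst hm
    rw [he00]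
    simp
  · have hm1 : (1 : ℝ) ≤ m := by exact_mod_cast hm
    have hkey : (m : ℝ) * g.gradSq (energyDensity h u) x ≤ 4 * ((m : ℝ) - 1) * S * e := by
      linarith
    calc (m : ℝ) * g.gradSq (energyDensity h u) x ≤ 4 * ((m : ℝ) - 1) * S * e := hkey
      _ = 2 * ((m : ℝ) - 1) * e * (2 * S) := by ring
      _ ≤ 2 * ((m : ℝ) - 1) * e * R := by
          apply mul_le_mul_of_nonneg_left hRS
          have : 0 ≤ (m : ℝ) - 1 := by linarith
          positivity

end Bochner

/-! ### Part E — Karpukhin–Stern Lemma 3.4 (p. 749) -/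

section Lemma34Pointwise

open Lorentzian Lorentzian.PseudoRiemannianMetric Bundle Filter

/-- `d/dσ (σ + t)^p = p (σ + t)^{p−1}` where `σ + t > 0`. [folklore] -/
theorem hasDerivAt_add_const_rpow {σ t : ℝ} (p : ℝ) (hσ : 0 < σ + t) :
    HasDerivAt (fun τ : ℝ ↦ (τ + t) ^ p) (p * (σ + t) ^ (p - 1)) σ := by
  have h1 : HasDerivAt (fun τ : ℝ ↦ τ + t) 1 σ := (hasDerivAt_id σ).add_const t
  have h2 := h1.rpow_const (p := p) (Or.inl hσ.ne')
  simpa using h2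

/-- The derivative of `σ ↦ (σ + t)^p` near a point with `σ₀ + t > 0`, as a function. [folklore] -/
theorem deriv_add_const_rpow_eventuallyEq {σ₀ t : ℝ} (p : ℝ) (hσ : 0 < σ₀ + t) :
    deriv (fun τ : ℝ ↦ (τ + t) ^ p) =ᶠ[𝓝 σ₀] fun τ ↦ p * (τ + t) ^ (p - 1) := by
  have hev : ∀ᶠ τ in 𝓝 σ₀, 0 < τ + t := by
    have h1 : Set.Ioi (-t) ∈ 𝓝 σ₀ := Ioi_mem_nhds (by linarith)
    filter_upwards [h1] with τ hτ
    simp only [Set.mem_Ioi] at hτ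
    linarith
  filter_upwards [hev] with τ hτ
  exact (hasDerivAt_add_const_rpow p hτ).deriv

/-- First and second derivative of `ζ(σ) = (σ + t)^p` at `σ₀` with `σ₀ + t > 0`. [folklore] -/
theorem derivs_add_const_rpow {σ₀ t : ℝ} (p : ℝ) (hσ : 0 < σ₀ + t) :
    deriv (fun τ : ℝ ↦ (τ + t) ^ p) σ₀ = p * (σ₀ + t) ^ (p - 1) ∧
      deriv (deriv fun τ : ℝ ↦ (τ + t) ^ p) σ₀ = p * ((p - 1) * (σ₀ + t) ^ (p - 2)) ∧
      ContDiffAt ℝ 2 (fun τ : ℝ ↦ (τ + t) ^ p) σ₀ := by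
  refine ⟨(hasDerivAt_add_const_rpow p hσ).deriv, ?_, ?_⟩
  · rw [(deriv_add_const_rpow_eventuallyEq p hσ).deriv_eq]
    have h := (hasDerivAt_add_const_rpow (p - 1) hσ).const_mul p
    rw [h.deriv, show p - 1 - 1 = p - 2 by ring]
  · exact (contDiffAt_id.add contDiffAt_const).rpow_const_of_ne hσ.ne'

variable {m : ℕ} {H' : Type*} [TopologicalSpace H']
  {J : ModelWithCorners ℝ (EuclideanSpace ℝ (Fin m)) H'} [J.Boundaryless]
  {N : Type*} [TopologicalSpace N] [ChartedSpace H' N] [IsManifold J ∞ N]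
  (h : ContMDiffRiemannianMetric J ∞ (EuclideanSpace ℝ (Fin m)) (TangentSpace J : N → Type _))
  [(ofRiemannian h).HasLeviCivita] {k : ℕ}

/-- **The pointwise input of Lemma 3.4** (Karpukhin–Stern p. 748, the display after (3.3):
"`(1/α) Δ|du|^α ⩾ Q(n, α)⁻¹ |d|du|^{α/2}|² − ‖Ric_M‖ |du|^α − ((n−1)/n) |du|^{2+α}`",
`Q(n, α)⁻¹ = (4/α²)(n/(n−1) + α − 2)`), in regularised form: for a smooth harmonic `u : N → Sᵏ`
(`dim N = m ≥ 2`, `Ric ≥ −K h`), `e = |du|²_h`, a real `α ≥ 2` and `t > 0`,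

  `|d (e + t)^{α/4}|²_h ≤ Q · [ (1/α) tr_h Hess ((e + t)^{α/2}) + (e + t)^{α/2 − 1} (K e + ((m−1)/m) e²) ]`,

`Q = α² / (4 (m/(m−1) + α − 2))`. Proof: the chain rules for `tr_h Hess` and `|d·|²`
(`dalembertian_real_comp`, `gradSq_real_comp`) and `kato_bochner_energyDensity`
(`(m/(2(m−1))) |de|² ≤ (e + t) R`, `R ≥ 0`); the constant `Q` is the one making the last step an
equality, exactly as in print. [cite: KarpukhinStern2024, §3.1 p. 748 (display after (3.3))] -/
theorem gradSq_rpow_le_dalembertian_rpow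
    {u : N → Metric.sphere (0 : EuclideanSpace ℝ (Fin (k + 1))) 1} (hu : ContMDiff J (𝓡 k) ∞ u)
    (harm : ∀ (i : Fin (k + 1)) (x : N), (ofRiemannian h).dalembertian
      (fun y ↦ (u y : EuclideanSpace ℝ (Fin (k + 1))) i) x =
        -(energyDensity h u x) * (u x : EuclideanSpace ℝ (Fin (k + 1))) i)
    {K : ℝ} (hK : ∀ (x : N) (v : TangentSpace J x),
      -(K * (ofRiemannian h).val x v v) ≤ (ofRiemannian h).ricci x v v)
    (hm : 2 ≤ m) {α : ℝ} (hα : 2 ≤ α) {t : ℝ} (ht : 0 < t) (x : N) :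
    (ofRiemannian h).gradSq (fun y ↦ (energyDensity h u y + t) ^ (α / 4)) x ≤
      α ^ 2 / (4 * ((m : ℝ) / ((m : ℝ) - 1) + α - 2)) *
        (1 / α * (ofRiemannian h).dalembertian (fun y ↦ (energyDensity h u y + t) ^ (α / 2)) x
          + (energyDensity h u x + t) ^ (α / 2 - 1) *
            (K * energyDensity h u x + ((m : ℝ) - 1) / m * energyDensity h u x ^ 2)) := by
  set g := ofRiemannian h with hg
  set e := energyDensity h u with hedef
  have he : ContMDiff J 𝓘(ℝ, ℝ) ∞ e := contMDiff_energyDensity h hu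
  have he2 : CMDiffAt 2 e x := (he.of_le (WithTop.coe_le_coe.mpr le_top)).contMDiffAt
  have hed : MDifferentiableAt J 𝓘(ℝ, ℝ) e x := he.mdifferentiableAt (by simp)
  have he0 : 0 ≤ e x := energyDensity_nonneg' h u x
  have het : 0 < e x + t := by linarith
  -- the two chain rules
  obtain ⟨hζ1, hζ2, hζc⟩ := derivs_add_const_rpow (α / 2) het
  obtain ⟨hη1, -, -⟩ := derivs_add_const_rpow (α / 4) het
  have hF : g.dalembertian (fun y ↦ (e y + t) ^ (α / 2)) x =
      α / 2 * ((α / 2 - 1) * (e x + t) ^ (α / 2 - 2)) * g.gradSq e x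
        + α / 2 * (e x + t) ^ (α / 2 - 1) * g.dalembertian e x := by
    have hcomp : (fun y ↦ (e y + t) ^ (α / 2)) = (fun τ : ℝ ↦ (τ + t) ^ (α / 2)) ∘ e := rfl
    rw [hcomp, g.dalembertian_real_comp he2 hζc, hζ1, hζ2]
    rfl
  have hG : g.gradSq (fun y ↦ (e y + t) ^ (α / 4)) x =
      (α / 4 * (e x + t) ^ (α / 4 - 1)) ^ 2 * g.gradSq e x := by
    have hcomp : (fun y ↦ (e y + t) ^ (α / 4)) = (fun τ : ℝ ↦ (τ + t) ^ (α / 4)) ∘ e := rfl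
    rw [hcomp, gradSq_real_comp h (hasDerivAt_add_const_rpow (α / 4) het).differentiableAt hed, hη1]
  -- (3.3)
  obtain ⟨hR0, hKB⟩ := kato_bochner_energyDensity h hu harm hK x
  set R := g.dalembertian e x + 2 * K * e x + (2 - 2 / m) * e x ^ 2 with hR
  set X := g.gradSq e x with hX
  have hX0 : 0 ≤ X := innerDual_self_nonneg g (isRiemannian_ofRiemannian h) x _
  have hm' : (2 : ℝ) ≤ m := by exact_mod_cast hm
  have hm1 : 0 < (m : ℝ) - 1 := by linarith
  have hm0 : 0 < (m : ℝ) := by linarith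
  -- `(m/(2(m−1))) X ≤ (e + t) R`
  have hdag : (m : ℝ) / (2 * ((m : ℝ) - 1)) * X ≤ (e x + t) * R := by
    rw [div_mul_eq_mul_div, div_le_iff₀ (by positivity)]
    have h1 : (m : ℝ) * X ≤ 2 * ((m : ℝ) - 1) * e x * R := hKB
    nlinarith [mul_nonneg hm1.le (mul_nonneg ht.le hR0)]
  -- powers of `e + t`
  set w := e x + t with hw
  have hw2 : w ^ (α / 2 - 1) = w ^ (α / 2 - 2) * w := by
    have : α / 2 - 1 = α / 2 - 2 + 1 := by ring
    rw [this, Real.rpow_add het, Real.rpow_one]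
  have hw4 : (α / 4 * w ^ (α / 4 - 1)) ^ 2 = α ^ 2 / 16 * w ^ (α / 2 - 2) := by
    rw [mul_pow, ← Real.rpow_natCast (w ^ (α / 4 - 1)) 2, ← Real.rpow_mul het.le]
    have : (α / 4 - 1) * ((2 : ℕ) : ℝ) = α / 2 - 2 := by push_cast; ring
    rw [this]
    ring
  have hwp : 0 ≤ w ^ (α / 2 - 2) := Real.rpow_nonneg het.le _
  -- the constant
  set c₁ : ℝ := (m : ℝ) / ((m : ℝ) - 1) with hc₁
  have hc₁' : c₁ = 2 * ((m : ℝ) / (2 * ((m : ℝ) - 1))) := by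
    rw [hc₁]
    field_simp
  have hden : 0 < c₁ + α - 2 := by
    have : 0 < c₁ := div_pos hm0 hm1
    linarith
  have hQpos : 0 < α ^ 2 / (4 * (c₁ + α - 2)) := by positivity
  rw [hG, hF, hw4]
  -- rewrite the right-hand side as `Q [ ((α−2)/4) w^{α/2−2} X + ½ w^{α/2−1} R ]`
  have hrhs : 1 / α * (α / 2 * ((α / 2 - 1) * w ^ (α / 2 - 2)) * X
        + α / 2 * w ^ (α / 2 - 1) * g.dalembertian e x)
        + w ^ (α / 2 - 1) * (K * e x + ((m : ℝ) - 1) / m * e x ^ 2) =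
      (α - 2) / 4 * w ^ (α / 2 - 2) * X + 1 / 2 * w ^ (α / 2 - 1) * R := by
    rw [hR]
    have hα0 : α ≠ 0 := by linarith
    field_simp
    ring
  rw [hrhs, hw2]
  -- use `hdag`: `½ w^{α/2−2} w R ≥ ½ w^{α/2−2} (m/(2(m−1))) X = (c₁/4) w^{α/2−2} X`
  have hstep : (α - 2) / 4 * w ^ (α / 2 - 2) * X + 1 / 2 * (w ^ (α / 2 - 2) * w) * R ≥
      ((α - 2) / 4 + c₁ / 4) * w ^ (α / 2 - 2) * X := by
    have h1 : w ^ (α / 2 - 2) * ((m : ℝ) / (2 * ((m : ℝ) - 1)) * X) ≤ w ^ (α / 2 - 2) * (w * R) :=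
      mul_le_mul_of_nonneg_left hdag hwp
    rw [hc₁']
    nlinarith
  have hQ : α ^ 2 / 16 * w ^ (α / 2 - 2) * X =
      α ^ 2 / (4 * (c₁ + α - 2)) * (((α - 2) / 4 + c₁ / 4) * w ^ (α / 2 - 2) * X) := by
    field_simp
    ring
  rw [hQ]
  exact mul_le_mul_of_nonneg_left hstep hQpos.le

end Lemma34Pointwise

section Lemma34

open Lorentzian Lorentzian.PseudoRiemannianMetric Bundle Filter Topology
open _root_.MeasureTheory

variable {m : ℕ} {H' : Type*} [TopologicalSpace H']
  {J : ModelWithCorners ℝ (EuclideanSpace ℝ (Fin m)) H'} [J.Boundaryless]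
  {N : Type*} [TopologicalSpace N] [ChartedSpace H' N] [IsManifold J ∞ N] [CompactSpace N]
  [T2Space N] [MeasurableSpace N] [BorelSpace N]
  (h : ContMDiffRiemannianMetric J ∞ (EuclideanSpace ℝ (Fin m)) (TangentSpace J : N → Type _))
  {k : ℕ}

omit [J.Boundaryless] in
/-- **The limit `t → 0⁺` of `∫ w (e + t)^p dμ_h`** for continuous `w`, continuous `e ≥ 0` and
`p ≥ 0` on a closed manifold (dominated convergence, bound `|w| (e + 1)^p` for `t < 1`).
[cite: KarpukhinStern2024, §3.1 p. 748] -/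
theorem tendsto_integral_mul_add_rpow {w e : N → ℝ} (hw : Continuous w) (he : Continuous e)
    (he0 : ∀ x, 0 ≤ e x) {p : ℝ} (hp : 0 ≤ p) :
    Tendsto (fun t : ℝ ↦ ∫ x, w x * (e x + t) ^ p ∂riemannianMeasure h) (𝓝[>] 0)
      (𝓝 (∫ x, w x * e x ^ p ∂riemannianMeasure h)) := by
  haveI := isFiniteMeasure_riemannianMeasure h
  have hI : Set.Ioo (0 : ℝ) 1 ∈ 𝓝[>] (0 : ℝ) := Ioo_mem_nhdsGT one_pos
  refine tendsto_integral_filter_of_dominated_convergence (fun x ↦ |w x| * (e x + 1) ^ p) ?_ ?_ ?_ ?_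
  · filter_upwards [hI] with t ht
    exact (hw.mul ((he.add continuous_const).rpow_const fun x ↦ Or.inr hp)).aestronglyMeasurable
  · filter_upwards [hI] with t ht
    refine Eventually.of_forall fun x ↦ ?_
    have h0 : 0 ≤ e x + t := add_nonneg (he0 x) ht.1.le
    rw [Real.norm_eq_abs, abs_mul, abs_of_nonneg (Real.rpow_nonneg h0 _)]
    refine mul_le_mul_of_nonneg_left (Real.rpow_le_rpow h0 (by linarith [ht.2]) hp) (abs_nonneg _)
  · exact integrable_of_continuous h
      ((continuous_abs.comp hw).mul ((he.add continuous_const).rpow_const fun x ↦ Or.inr hp))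
  · refine Eventually.of_forall fun x ↦ ?_
    have hc : ContinuousAt (fun t : ℝ ↦ w x * (e x + t) ^ p) 0 :=
      (continuous_const.mul ((continuous_const.add continuous_id).rpow_const
        fun t ↦ Or.inr hp)).continuousAt
    have h0 : (fun t : ℝ ↦ w x * (e x + t) ^ p) 0 = w x * e x ^ p := by simp
    rw [← h0]
    exact hc.tendsto.mono_left nhdsWithin_le_nhds

variable [(ofRiemannian h).HasLeviCivita]

omit [CompactSpace N] [T2Space N] [MeasurableSpace N] [BorelSpace N] [J.Boundaryless]
  [(ofRiemannian h).HasLeviCivita] in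
/-- **`|d(φG)|² = G² |dφ|² + ½ h⁻¹(d(φ²), d(G²)) + φ² |dG|²`** at a point where `φ, G` are
differentiable (product rule and `h⁻¹(d(φ²), d(G²)) = 4 φ G h⁻¹(dφ, dG)`). Karpukhin–Stern p. 748:
"`|d(ϕ|du|^{α/2})|² = |du|^α |dϕ|² + ½⟨d(ϕ²), d|du|^α⟩ + ϕ² |d|du|^{α/2}|²`".
[cite: KarpukhinStern2024, §3.1 p. 748] -/
theorem gradSq_mul_eq {φ G : N → ℝ} {x : N} (hφ : MDifferentiableAt J 𝓘(ℝ, ℝ) φ x)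
    (hG : MDifferentiableAt J 𝓘(ℝ, ℝ) G x) :
    (ofRiemannian h).gradSq (fun y ↦ φ y * G y) x =
      G x ^ 2 * (ofRiemannian h).gradSq φ x
        + 1 / 2 * (ofRiemannian h).innerDual x
            (mvfderiv J (fun y ↦ φ y ^ 2) x : TangentSpace J x →ₗ[ℝ] ℝ)
            (mvfderiv J (fun y ↦ G y ^ 2) x : TangentSpace J x →ₗ[ℝ] ℝ)
        + φ x ^ 2 * (ofRiemannian h).gradSq G x := by
  set g := ofRiemannian h with hg
  have hd : (mvfderiv J (fun y ↦ φ y * G y) x : TangentSpace J x →ₗ[ℝ] ℝ) =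
      φ x • (mvfderiv J G x : TangentSpace J x →ₗ[ℝ] ℝ) +
        G x • (mvfderiv J φ x : TangentSpace J x →ₗ[ℝ] ℝ) := by
    rw [mvfderiv_fun_mul hφ hG, ContinuousLinearMap.toLinearMap_add,
      ContinuousLinearMap.toLinearMap_smul, ContinuousLinearMap.toLinearMap_smul]
  have hφ2 : (mvfderiv J (fun y ↦ φ y ^ 2) x : TangentSpace J x →ₗ[ℝ] ℝ) =
      (2 * φ x) • (mvfderiv J φ x : TangentSpace J x →ₗ[ℝ] ℝ) := by
    have hfun : (fun y ↦ φ y ^ 2) = fun y ↦ φ y * φ y := by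
      funext y
      ring
    rw [hfun, mvfderiv_fun_mul hφ hφ, ContinuousLinearMap.toLinearMap_add,
      ContinuousLinearMap.toLinearMap_smul, ← add_smul, ← two_mul]
  have hG2 : (mvfderiv J (fun y ↦ G y ^ 2) x : TangentSpace J x →ₗ[ℝ] ℝ) =
      (2 * G x) • (mvfderiv J G x : TangentSpace J x →ₗ[ℝ] ℝ) := by
    have hfun : (fun y ↦ G y ^ 2) = fun y ↦ G y * G y := by
      funext y
      ring
    rw [hfun, mvfderiv_fun_mul hG hG, ContinuousLinearMap.toLinearMap_add,
      ContinuousLinearMap.toLinearMap_smul, ← add_smul, ← two_mul]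
  simp only [PseudoRiemannianMetric.gradSq]
  rw [hd, hφ2, hG2]
  simp only [g.innerDual_add_left, g.innerDual_smul_left, g.innerDual_smul_right,
    g.innerDual_comm x (mvfderiv J G x : TangentSpace J x →ₗ[ℝ] ℝ)
      ((φ x • (mvfderiv J G x : TangentSpace J x →ₗ[ℝ] ℝ)) +
        G x • (mvfderiv J φ x : TangentSpace J x →ₗ[ℝ] ℝ)),
    g.innerDual_comm x (mvfderiv J φ x : TangentSpace J x →ₗ[ℝ] ℝ)
      ((φ x • (mvfderiv J G x : TangentSpace J x →ₗ[ℝ] ℝ)) +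
        G x • (mvfderiv J φ x : TangentSpace J x →ₗ[ℝ] ℝ)),
    g.innerDual_comm x (mvfderiv J G x : TangentSpace J x →ₗ[ℝ] ℝ)
      (mvfderiv J φ x : TangentSpace J x →ₗ[ℝ] ℝ)]
  ring

/-- **Karpukhin–Stern, Lemma 3.4** (p. 749). Let `u : N → Sᵏ` be a smooth harmonic map on a
closed Riemannian manifold of dimension `m ≥ 2` with `Ric ≥ −K h`, `Ω ⊆ N` with
`ind_E(u; Ω) ≤ M`, `M + 2 < k` (so `p := k − 2 − M ≥ 1` and `p/(p+3) = (k−2−M)/(k−M+1)`),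
`α ≥ 2` real and `φ` smooth with `tsupport φ ⊆ Ω`. With `e = |du|²_h` (so `|du|^α = e^{α/2}`),
`Q = Q(m, α) = α²/(4(m/(m−1) + α − 2))`:

  `(k − 2 − M) ∫ φ² e^{α/2+1} ≤ (k − M + 1) [ ∫ e^{α/2} |dφ|² + (Q/α − ½) ∫ e^{α/2} tr_h Hess(φ²)
      + Q K ∫ φ² e^{α/2} + Q ((m−1)/m) ∫ φ² e^{α/2+1} ]`,

i.e. `(p/(p+3) − P(m, α)) ∫ φ²|du|^{2+α} ≤ ∫ (|dφ|² + (Q/α − ½) tr Hess(φ²) + QK φ²) |du|^α` with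
`P(m, α) = Q(m, α)(m−1)/m` — the printed statement
"`(p/(p+3) − P(n, α)) ∫ ϕ²|du|^{2+α} ⩽ C_α ∫ (|dϕ|² + |ϕ||Δϕ|) |du|^α`" with its constant made
explicit (`tr Hess(φ²) = 2φ tr Hess φ + 2|dφ|²`). Proof as printed (pp. 748–749), with the
regularisation `|du| ↦ (e + t)^{1/2}`, `t → 0⁺`, that makes every test function smooth:
Lemma 3.3 (`karpukhinStern_lemma33_on`) for `ψ = φ (e + t)^{α/4}`; the expansion
`|dψ|² = (e+t)^{α/2}|dφ|² + ½ h⁻¹(d(φ²), d(e+t)^{α/2}) + φ²|d(e+t)^{α/4}|²` (`gradSq_mul_eq`); the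
pointwise bound `gradSq_rpow_le_dalembertian_rpow` ((3.3) with the refined Kato inequality);
Green's identities `∫ h⁻¹(d(φ²), dF) = −∫ F tr Hess(φ²) = −∫ φ² tr Hess F`
(`integral_mul_dalembertian_eq_neg_integral_innerDual`); `(e+t)^{α/2} ≥ e^{α/2}` on the left; and
`t → 0⁺` by dominated convergence (`tendsto_integral_mul_add_rpow`).
[cite: KarpukhinStern2024, Lemma 3.4 p. 749] -/
theorem karpukhinStern_lemma34
    {u : N → Metric.sphere (0 : EuclideanSpace ℝ (Fin (k + 1))) 1} (hu : ContMDiff J (𝓡 k) ∞ u)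
    (harm : ∀ (i : Fin (k + 1)) (x : N), (ofRiemannian h).dalembertian
      (fun y ↦ (u y : EuclideanSpace ℝ (Fin (k + 1))) i) x =
        -(energyDensity h u x) * (u x : EuclideanSpace ℝ (Fin (k + 1))) i)
    {K : ℝ} (hK : ∀ (x : N) (v : TangentSpace J x),
      -(K * (ofRiemannian h).val x v v) ≤ (ofRiemannian h).ricci x v v)
    (hm : 2 ≤ m) {α : ℝ} (hα : 2 ≤ α)
    {Ω : Set N} {φ : N → ℝ} (hφ : ContMDiff J 𝓘(ℝ, ℝ) ∞ φ) (hφΩ : tsupport φ ⊆ Ω) {M : ℕ}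
    (hind : energyIndexOn h hu Ω ≤ M) (hMk : M + 2 < k) :
    ((k : ℝ) - 2 - M) * ∫ x, φ x ^ 2 * energyDensity h u x ^ (α / 2 + 1) ∂riemannianMeasure h ≤
      ((k : ℝ) - M + 1) *
        (∫ x, (ofRiemannian h).gradSq φ x * energyDensity h u x ^ (α / 2) ∂riemannianMeasure h
          + (α ^ 2 / (4 * ((m : ℝ) / ((m : ℝ) - 1) + α - 2)) / α - 1 / 2) *
              ∫ x, (ofRiemannian h).dalembertian (fun y ↦ φ y ^ 2) x * energyDensity h u x ^ (α / 2)
                ∂riemannianMeasure h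
          + α ^ 2 / (4 * ((m : ℝ) / ((m : ℝ) - 1) + α - 2)) * K *
              ∫ x, φ x ^ 2 * energyDensity h u x ^ (α / 2) ∂riemannianMeasure h
          + α ^ 2 / (4 * ((m : ℝ) / ((m : ℝ) - 1) + α - 2)) * (((m : ℝ) - 1) / m) *
              ∫ x, φ x ^ 2 * energyDensity h u x ^ (α / 2 + 1) ∂riemannianMeasure h) := by
  set g := ofRiemannian h with hg
  set e := energyDensity h u with hedef
  set μ := riemannianMeasure h with hμ
  set Q : ℝ := α ^ 2 / (4 * ((m : ℝ) / ((m : ℝ) - 1) + α - 2)) with hQ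
  have he : ContMDiff J 𝓘(ℝ, ℝ) ∞ e := contMDiff_energyDensity h hu
  have hec : Continuous e := he.continuous
  have he0 : ∀ x, 0 ≤ e x := fun x ↦ energyDensity_nonneg' h u x
  have hφc : Continuous φ := hφ.continuous
  have hφd : ∀ x, MDifferentiableAt J 𝓘(ℝ, ℝ) φ x := fun x ↦ hφ.mdifferentiableAt (by simp)
  have hφ2 : ContMDiff J 𝓘(ℝ, ℝ) ∞ (fun y ↦ φ y ^ 2) := hφ.pow 2
  have hα2 : 0 ≤ α / 2 := by linarith
  have hα21 : 0 ≤ α / 2 - 1 := by linarith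
  have hkM : 0 < (k : ℝ) - 2 - M := by
    have : (M : ℝ) + 2 < k := by exact_mod_cast hMk
    linarith
  have hkM' : 0 < (k : ℝ) - M + 1 := by linarith
  -- continuity of the weights
  have hw1 : Continuous (g.gradSq φ) := (contMDiff_gradSq g hφ).continuous
  have hw2 : Continuous (g.dalembertian fun y ↦ φ y ^ 2) := (contMDiff_dalembertian g hφ2).continuous
  have hw3 : Continuous fun x ↦ φ x ^ 2 * e x := (hφc.pow 2).mul hec
  have hw4 : Continuous fun x ↦ φ x ^ 2 * e x ^ 2 := (hφc.pow 2).mul (hec.pow 2)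
  -- the regularised inequality, for every `t > 0`
  have key : ∀ t : ℝ, 0 < t →
      ((k : ℝ) - 2 - M) * ∫ x, φ x ^ 2 * e x ^ (α / 2 + 1) ∂μ ≤
        ((k : ℝ) - M + 1) *
          (∫ x, g.gradSq φ x * (e x + t) ^ (α / 2) ∂μ
            + (Q / α - 1 / 2) * ∫ x, g.dalembertian (fun y ↦ φ y ^ 2) x * (e x + t) ^ (α / 2) ∂μ
            + Q * K * ∫ x, φ x ^ 2 * e x * (e x + t) ^ (α / 2 - 1) ∂μ
            + Q * (((m : ℝ) - 1) / m) * ∫ x, φ x ^ 2 * e x ^ 2 * (e x + t) ^ (α / 2 - 1) ∂μ) := by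
    intro t ht
    have hpos : ∀ y, 0 < e y + t := fun y ↦ by linarith [he0 y]
    set G : N → ℝ := fun y ↦ (e y + t) ^ (α / 4) with hGdef
    set F : N → ℝ := fun y ↦ (e y + t) ^ (α / 2) with hFdef
    have het : ContMDiff J 𝓘(ℝ, ℝ) ∞ fun y ↦ e y + t := he.add contMDiff_const
    have hGs : ContMDiff J 𝓘(ℝ, ℝ) ∞ G := contMDiff_rpow_of_pos het hpos (α / 4)
    have hFs : ContMDiff J 𝓘(ℝ, ℝ) ∞ F := contMDiff_rpow_of_pos het hpos (α / 2)
    have hGd : ∀ x, MDifferentiableAt J 𝓘(ℝ, ℝ) G x := fun x ↦ hGs.mdifferentiableAt (by simp)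
    have hGF : ∀ y, G y ^ 2 = F y := by
      intro y
      simp only [hGdef, hFdef]
      rw [← Real.rpow_natCast ((e y + t) ^ (α / 4)) 2, ← Real.rpow_mul (hpos y).le]
      congr 1
      push_cast
      ring
    have hGF' : (fun y ↦ G y ^ 2) = F := funext hGF
    set ψ : N → ℝ := fun y ↦ φ y * G y with hψdef
    have hψs : ContMDiff J 𝓘(ℝ, ℝ) ∞ ψ := hφ.mul hGs
    have hψΩ : tsupport ψ ⊆ Ω :=
      (tsupport_mul_subset_left (f := φ) (g := G)).trans hφΩ
    -- Lemma 3.3 for `ψ`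
    have h33 := karpukhinStern_lemma33_on h hu harm hψs hψΩ hind hMk
    -- the left side: `φ² e^{α/2+1} ≤ ψ² e`
    have hL : ∫ x, φ x ^ 2 * e x ^ (α / 2 + 1) ∂μ ≤ ∫ x, ψ x ^ 2 * e x ∂μ := by
      refine integral_mono (integrable_of_continuous h ((hφc.pow 2).mul (hec.rpow_const
        fun x ↦ Or.inr (by linarith)))) (integrable_of_continuous h ((hψs.continuous.pow 2).mul hec))
        fun x ↦ ?_
      have h1 : e x ^ (α / 2 + 1) = e x ^ (α / 2) * e x := Real.rpow_add_one' (he0 x) (by linarith)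
      have h2 : e x ^ (α / 2) ≤ (e x + t) ^ (α / 2) :=
        Real.rpow_le_rpow (he0 x) (by linarith) hα2
      have h3 : ψ x ^ 2 = φ x ^ 2 * (e x + t) ^ (α / 2) := by
        simp only [hψdef, mul_pow, hGF x, hFdef]
      rw [h1, h3]
      have : 0 ≤ φ x ^ 2 * e x := mul_nonneg (sq_nonneg _) (he0 x)
      nlinarith
    -- the right side
    have hpt : ∀ x, g.innerDual x (mvfderiv J ψ x).toLinearMap (mvfderiv J ψ x).toLinearMap =
        F x * g.gradSq φ x + 1 / 2 * g.innerDual x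
            (mvfderiv J (fun y ↦ φ y ^ 2) x : TangentSpace J x →ₗ[ℝ] ℝ)
            (mvfderiv J F x : TangentSpace J x →ₗ[ℝ] ℝ)
          + φ x ^ 2 * g.gradSq G x := by
      intro x
      have h1 := gradSq_mul_eq h (hφd x) (hGd x)
      rw [hGF', hGF x] at h1
      exact h1
    have hI1 : Integrable (fun x ↦ F x * g.gradSq φ x) μ :=
      integrable_of_continuous h (hFs.continuous.mul hw1)
    have hI2 : Integrable (fun x ↦ 1 / 2 * g.innerDual x
        (mvfderiv J (fun y ↦ φ y ^ 2) x : TangentSpace J x →ₗ[ℝ] ℝ)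
        (mvfderiv J F x : TangentSpace J x →ₗ[ℝ] ℝ)) μ :=
      integrable_of_continuous h (continuous_const.mul (contMDiff_innerDual g hφ2 hFs).continuous)
    have hI3 : Integrable (fun x ↦ φ x ^ 2 * g.gradSq G x) μ :=
      integrable_of_continuous h ((hφc.pow 2).mul (contMDiff_gradSq g hGs).continuous)
    have hsplit : ∫ x, g.innerDual x (mvfderiv J ψ x).toLinearMap (mvfderiv J ψ x).toLinearMap ∂μ =
        ∫ x, F x * g.gradSq φ x ∂μ
          + 1 / 2 * ∫ x, g.innerDual x (mvfderiv J (fun y ↦ φ y ^ 2) x : TangentSpace J x →ₗ[ℝ] ℝ)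
              (mvfderiv J F x : TangentSpace J x →ₗ[ℝ] ℝ) ∂μ
          + ∫ x, φ x ^ 2 * g.gradSq G x ∂μ := by
      have hI12 : Integrable (fun x ↦ F x * g.gradSq φ x + 1 / 2 * g.innerDual x
          (mvfderiv J (fun y ↦ φ y ^ 2) x : TangentSpace J x →ₗ[ℝ] ℝ)
          (mvfderiv J F x : TangentSpace J x →ₗ[ℝ] ℝ)) μ := hI1.add hI2
      simp_rw [hpt]
      rw [integral_add hI12 hI3, integral_add hI1 hI2, integral_const_mul]
    -- Green's identities
    have hGreen1 : ∫ x, g.innerDual x (mvfderiv J (fun y ↦ φ y ^ 2) x : TangentSpace J x →ₗ[ℝ] ℝ)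
        (mvfderiv J F x : TangentSpace J x →ₗ[ℝ] ℝ) ∂μ =
        -∫ x, g.dalembertian (fun y ↦ φ y ^ 2) x * F x ∂μ := by
      have h1 := integral_mul_dalembertian_eq_neg_integral_innerDual h (u := F) (f := fun y ↦ φ y ^ 2)
        (hFs.of_le (by exact_mod_cast le_top)) (hφ2.of_le (WithTop.coe_le_coe.mpr le_top))
      have h2 : ∫ x, g.dalembertian (fun y ↦ φ y ^ 2) x * F x ∂μ =
          ∫ x, F x * g.dalembertian (fun y ↦ φ y ^ 2) x ∂μ :=
        integral_congr_ae (Eventually.of_forall fun x ↦ mul_comm _ _)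
      rw [h2, h1, neg_neg]
      exact integral_congr_ae (Eventually.of_forall fun x ↦ g.innerDual_comm x _ _)
    have hGreen2 : ∫ x, φ x ^ 2 * g.dalembertian F x ∂μ =
        ∫ x, g.dalembertian (fun y ↦ φ y ^ 2) x * F x ∂μ := by
      have h1 := integral_mul_dalembertian_eq_neg_integral_innerDual h (u := fun y ↦ φ y ^ 2) (f := F)
        (hφ2.of_le (by exact_mod_cast le_top)) (hFs.of_le (WithTop.coe_le_coe.mpr le_top))
      rw [h1]
      change -∫ x, g.innerDual x (mvfderiv J (fun y ↦ φ y ^ 2) x : TangentSpace J x →ₗ[ℝ] ℝ)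
          (mvfderiv J F x : TangentSpace J x →ₗ[ℝ] ℝ) ∂μ =
        ∫ x, g.dalembertian (fun y ↦ φ y ^ 2) x * F x ∂μ
      rw [hGreen1, neg_neg]
    -- the pointwise bound (3.3)′ integrated against `φ²`
    have hI4 : Integrable (fun x ↦ φ x ^ 2 * g.dalembertian F x) μ :=
      integrable_of_continuous h ((hφc.pow 2).mul (contMDiff_dalembertian g hFs).continuous)
    have hI5 : Integrable (fun x ↦ φ x ^ 2 * e x * (e x + t) ^ (α / 2 - 1)) μ :=
      integrable_of_continuous h (hw3.mul ((hec.add continuous_const).rpow_const fun x ↦ Or.inr hα21))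
    have hI6 : Integrable (fun x ↦ φ x ^ 2 * e x ^ 2 * (e x + t) ^ (α / 2 - 1)) μ :=
      integrable_of_continuous h (hw4.mul ((hec.add continuous_const).rpow_const fun x ↦ Or.inr hα21))
    have hI4' : Integrable (fun x ↦ Q / α * (φ x ^ 2 * g.dalembertian F x)) μ := hI4.const_mul _
    have hI5' : Integrable (fun x ↦ Q * K * (φ x ^ 2 * e x * (e x + t) ^ (α / 2 - 1))) μ :=
      hI5.const_mul _
    have hI6' : Integrable (fun x ↦ Q * (((m : ℝ) - 1) / m) *
        (φ x ^ 2 * e x ^ 2 * (e x + t) ^ (α / 2 - 1))) μ := hI6.const_mul _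
    have hI45 : Integrable (fun x ↦ Q / α * (φ x ^ 2 * g.dalembertian F x)
        + Q * K * (φ x ^ 2 * e x * (e x + t) ^ (α / 2 - 1))) μ := hI4'.add hI5'
    have hI456 : Integrable (fun x ↦ Q / α * (φ x ^ 2 * g.dalembertian F x)
        + Q * K * (φ x ^ 2 * e x * (e x + t) ^ (α / 2 - 1))
        + Q * (((m : ℝ) - 1) / m) * (φ x ^ 2 * e x ^ 2 * (e x + t) ^ (α / 2 - 1))) μ :=
      hI45.add hI6'
    have hstar : ∫ x, φ x ^ 2 * g.gradSq G x ∂μ ≤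
        Q / α * ∫ x, φ x ^ 2 * g.dalembertian F x ∂μ
          + Q * K * ∫ x, φ x ^ 2 * e x * (e x + t) ^ (α / 2 - 1) ∂μ
          + Q * (((m : ℝ) - 1) / m) * ∫ x, φ x ^ 2 * e x ^ 2 * (e x + t) ^ (α / 2 - 1) ∂μ := by
      have h1 : ∀ x, φ x ^ 2 * g.gradSq G x ≤
          Q / α * (φ x ^ 2 * g.dalembertian F x)
            + Q * K * (φ x ^ 2 * e x * (e x + t) ^ (α / 2 - 1))
            + Q * (((m : ℝ) - 1) / m) * (φ x ^ 2 * e x ^ 2 * (e x + t) ^ (α / 2 - 1)) := by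
        intro x
        have h2 := mul_le_mul_of_nonneg_left
          (gradSq_rpow_le_dalembertian_rpow h hu harm hK hm hα ht x) (sq_nonneg (φ x))
        have h3 : φ x ^ 2 * (α ^ 2 / (4 * ((m : ℝ) / ((m : ℝ) - 1) + α - 2)) *
            (1 / α * g.dalembertian (fun y ↦ (e y + t) ^ (α / 2)) x
              + (e x + t) ^ (α / 2 - 1) * (K * e x + ((m : ℝ) - 1) / m * e x ^ 2))) =
            Q / α * (φ x ^ 2 * g.dalembertian F x)
              + Q * K * (φ x ^ 2 * e x * (e x + t) ^ (α / 2 - 1))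
              + Q * (((m : ℝ) - 1) / m) * (φ x ^ 2 * e x ^ 2 * (e x + t) ^ (α / 2 - 1)) := by
          simp only [hQ, hFdef]
          ring
        rw [h3] at h2
        exact h2
      calc ∫ x, φ x ^ 2 * g.gradSq G x ∂μ
          ≤ ∫ x, (Q / α * (φ x ^ 2 * g.dalembertian F x)
            + Q * K * (φ x ^ 2 * e x * (e x + t) ^ (α / 2 - 1))
            + Q * (((m : ℝ) - 1) / m) * (φ x ^ 2 * e x ^ 2 * (e x + t) ^ (α / 2 - 1))) ∂μ :=
            integral_mono hI3 hI456 h1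
        _ = Q / α * ∫ x, φ x ^ 2 * g.dalembertian F x ∂μ
          + Q * K * ∫ x, φ x ^ 2 * e x * (e x + t) ^ (α / 2 - 1) ∂μ
          + Q * (((m : ℝ) - 1) / m) * ∫ x, φ x ^ 2 * e x ^ 2 * (e x + t) ^ (α / 2 - 1) ∂μ := by
            rw [integral_add hI45 hI6', integral_add hI4' hI5', integral_const_mul, integral_const_mul,
              integral_const_mul]
    -- assemble the right side
    have hcomm1 : ∫ x, F x * g.gradSq φ x ∂μ = ∫ x, g.gradSq φ x * (e x + t) ^ (α / 2) ∂μ :=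
      integral_congr_ae (Eventually.of_forall fun x ↦ mul_comm _ _)
    have hcomm2 : ∫ x, g.dalembertian (fun y ↦ φ y ^ 2) x * F x ∂μ =
        ∫ x, g.dalembertian (fun y ↦ φ y ^ 2) x * (e x + t) ^ (α / 2) ∂μ := rfl
    have hR : ∫ x, g.innerDual x (mvfderiv J ψ x).toLinearMap (mvfderiv J ψ x).toLinearMap ∂μ ≤
        ∫ x, g.gradSq φ x * (e x + t) ^ (α / 2) ∂μ
          + (Q / α - 1 / 2) * ∫ x, g.dalembertian (fun y ↦ φ y ^ 2) x * (e x + t) ^ (α / 2) ∂μ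
          + Q * K * ∫ x, φ x ^ 2 * e x * (e x + t) ^ (α / 2 - 1) ∂μ
          + Q * (((m : ℝ) - 1) / m) * ∫ x, φ x ^ 2 * e x ^ 2 * (e x + t) ^ (α / 2 - 1) ∂μ := by
      rw [hsplit, hGreen1, hcomm1, ← hcomm2]
      rw [hGreen2] at hstar
      linarith
    calc ((k : ℝ) - 2 - M) * ∫ x, φ x ^ 2 * e x ^ (α / 2 + 1) ∂μ
        ≤ ((k : ℝ) - 2 - M) * ∫ x, ψ x ^ 2 * e x ∂μ := mul_le_mul_of_nonneg_left hL hkM.le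
      _ ≤ ((k : ℝ) - M + 1) *
          ∫ x, g.innerDual x (mvfderiv J ψ x).toLinearMap (mvfderiv J ψ x).toLinearMap ∂μ := h33
      _ ≤ _ := mul_le_mul_of_nonneg_left hR hkM'.le
  -- the limit `t → 0⁺`
  have hlim : Tendsto (fun t : ℝ ↦ ((k : ℝ) - M + 1) *
      (∫ x, g.gradSq φ x * (e x + t) ^ (α / 2) ∂μ
        + (Q / α - 1 / 2) * ∫ x, g.dalembertian (fun y ↦ φ y ^ 2) x * (e x + t) ^ (α / 2) ∂μ
        + Q * K * ∫ x, φ x ^ 2 * e x * (e x + t) ^ (α / 2 - 1) ∂μ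
        + Q * (((m : ℝ) - 1) / m) * ∫ x, φ x ^ 2 * e x ^ 2 * (e x + t) ^ (α / 2 - 1) ∂μ))
      (𝓝[>] 0)
      (𝓝 (((k : ℝ) - M + 1) *
        (∫ x, g.gradSq φ x * e x ^ (α / 2) ∂μ
          + (Q / α - 1 / 2) * ∫ x, g.dalembertian (fun y ↦ φ y ^ 2) x * e x ^ (α / 2) ∂μ
          + Q * K * ∫ x, φ x ^ 2 * e x * e x ^ (α / 2 - 1) ∂μ
          + Q * (((m : ℝ) - 1) / m) * ∫ x, φ x ^ 2 * e x ^ 2 * e x ^ (α / 2 - 1) ∂μ))) := by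
    refine Tendsto.const_mul _ (((Tendsto.add ?_ (Tendsto.const_mul _ ?_)).add
      (Tendsto.const_mul _ ?_)).add (Tendsto.const_mul _ ?_))
    · exact tendsto_integral_mul_add_rpow h hw1 hec he0 hα2
    · exact tendsto_integral_mul_add_rpow h hw2 hec he0 hα2
    · exact tendsto_integral_mul_add_rpow h hw3 hec he0 hα21
    · exact tendsto_integral_mul_add_rpow h hw4 hec he0 hα21
  have hev : ∀ᶠ t in 𝓝[>] (0 : ℝ), ((k : ℝ) - 2 - M) * ∫ x, φ x ^ 2 * e x ^ (α / 2 + 1) ∂μ ≤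
      ((k : ℝ) - M + 1) *
        (∫ x, g.gradSq φ x * (e x + t) ^ (α / 2) ∂μ
          + (Q / α - 1 / 2) * ∫ x, g.dalembertian (fun y ↦ φ y ^ 2) x * (e x + t) ^ (α / 2) ∂μ
          + Q * K * ∫ x, φ x ^ 2 * e x * (e x + t) ^ (α / 2 - 1) ∂μ
          + Q * (((m : ℝ) - 1) / m) * ∫ x, φ x ^ 2 * e x ^ 2 * (e x + t) ^ (α / 2 - 1) ∂μ) := by
    filter_upwards [self_mem_nhdsWithin] with t ht
    exact key t ht
  have hfin := ge_of_tendsto hlim hev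
  -- rewrite the powers of `e` in the limit
  have hp1 : ∀ x, φ x ^ 2 * e x * e x ^ (α / 2 - 1) = φ x ^ 2 * e x ^ (α / 2) := by
    intro x
    have : e x ^ (α / 2) = e x ^ (α / 2 - 1) * e x := by
      rw [← Real.rpow_add_one' (he0 x) (by linarith)]
      ring_nf
    rw [this]
    ring
  have hp2 : ∀ x, φ x ^ 2 * e x ^ 2 * e x ^ (α / 2 - 1) = φ x ^ 2 * e x ^ (α / 2 + 1) := by
    intro x
    have h1 : e x ^ (α / 2 + 1) = e x ^ (α / 2) * e x := Real.rpow_add_one' (he0 x) (by linarith)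
    have h2 : e x ^ (α / 2) = e x ^ (α / 2 - 1) * e x := by
      rw [← Real.rpow_add_one' (he0 x) (by linarith)]
      ring_nf
    rw [h1, h2]
    ring
  simp_rw [hp1, hp2] at hfin
  exact hfin

end Lemma34

/-! ### Part F — toward Proposition 3.5: Lemma 3.4 with a cut-off, and the local index is monotone -/

section Prop35

open Lorentzian Lorentzian.PseudoRiemannianMetric Bundle Filter Topology
open _root_.MeasureTheory

variable {m : ℕ} {H' : Type*} [TopologicalSpace H']
  {J : ModelWithCorners ℝ (EuclideanSpace ℝ (Fin m)) H'} [J.Boundaryless]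
  {N : Type*} [TopologicalSpace N] [ChartedSpace H' N] [IsManifold J ∞ N] [CompactSpace N]
  [T2Space N] [MeasurableSpace N] [BorelSpace N]
  (h : ContMDiffRiemannianMetric J ∞ (EuclideanSpace ℝ (Fin m)) (TangentSpace J : N → Type _))
  {k : ℕ}

/-- **The local index is monotone in the domain**: `Ω ⊆ Ω' ⇒ ind_E(u; Ω) ≤ ind_E(u; Ω')`
(sections supported in `Ω` are supported in `Ω'`; `negIndex_comp_le`). Used in the proof of
Prop. 3.5 (Lemma 3.4 on `B_r ⊆ B_{2r}`) and of Lemma 3.7. [cite: KarpukhinStern2024, §2 p. 724] -/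
theorem energyIndexOn_mono {u : N → Metric.sphere (0 : EuclideanSpace ℝ (Fin (k + 1))) 1}
    (hu : ContMDiff J (𝓡 k) ∞ u) {Ω Ω' : Set N} (hΩ : Ω ⊆ Ω') :
    energyIndexOn h hu Ω ≤ energyIndexOn h hu Ω' := by
  have hle : tangentSectionsOn J u Ω ≤ tangentSectionsOn J u Ω' := fun v hv ↦ ⟨hv.1, hv.2.trans hΩ⟩
  have hfact : (secondVariation h hu).comp (Submodule.inclusion (tangentSectionsOn_le u Ω)) =
      ((secondVariation h hu).comp (Submodule.inclusion (tangentSectionsOn_le u Ω'))).comp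
        (Submodule.inclusion hle) := by
    ext v
    rfl
  unfold energyIndexOn
  rw [hfact]
  exact negIndex_comp_le _ _

omit [J.Boundaryless] in
/-- **Integrating a bounded weight supported in `Ω` against a nonnegative function**:
if `|w| ≤ A`, `w = 0` off `Ω` and `f ≥ 0` is continuous, then `|∫ w f dμ_h| ≤ A ∫_Ω f dμ_h`.
[folklore] -/
theorem abs_integral_mul_le_mul_setIntegral {w f : N → ℝ} (hw : Continuous w) (hf : Continuous f)
    (hf0 : ∀ x, 0 ≤ f x) {A : ℝ} (hA : ∀ x, |w x| ≤ A) {Ω : Set N} (hΩ : ∀ x ∉ Ω, w x = 0) :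
    |∫ x, w x * f x ∂riemannianMeasure h| ≤ A * ∫ x in Ω, f x ∂riemannianMeasure h := by
  have hint : Integrable (fun x ↦ w x * f x) (riemannianMeasure h) :=
    integrable_of_continuous h (hw.mul hf)
  have hintf : Integrable f (riemannianMeasure h) := integrable_of_continuous h hf
  have h1 : ∫ x, w x * f x ∂riemannianMeasure h = ∫ x in Ω, w x * f x ∂riemannianMeasure h :=
    (setIntegral_eq_integral_of_forall_compl_eq_zero fun x hx ↦ by rw [hΩ x hx, zero_mul]).symm
  rw [h1]
  calc |∫ x in Ω, w x * f x ∂riemannianMeasure h|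
      ≤ ∫ x in Ω, |w x * f x| ∂riemannianMeasure h := by
        rw [← Real.norm_eq_abs]
        exact norm_integral_le_integral_norm _
    _ ≤ ∫ x in Ω, A * f x ∂riemannianMeasure h := by
        refine setIntegral_mono hint.abs.integrableOn (hintf.const_mul A).integrableOn fun x ↦ ?_
        rw [abs_mul, abs_of_nonneg (hf0 x)]
        exact mul_le_mul_of_nonneg_right (hA x) (hf0 x)
    _ = A * ∫ x in Ω, f x ∂riemannianMeasure h := integral_const_mul _ _

variable [(ofRiemannian h).HasLeviCivita]

/-- **Lemma 3.4 with a cut-off** (the form used in the proof of Prop. 3.5, pp. 749–750): under the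
hypotheses of `karpukhinStern_lemma34`, if moreover `K ≥ 0`, `|φ| ≤ 1`, `|dφ|²_h ≤ a` and
`|tr_h Hess(φ²)| ≤ b` everywhere, then with `Q = Q(m, α)`, `P = Q (m−1)/m`,

  `((k − 2 − M) − (k − M + 1) P) ∫ φ² e^{α/2+1} ≤ (k − M + 1)(a + |Q/α − ½| b + Q K) ∫_Ω e^{α/2}`

("`∫ φ²|du|^{2+α} ⩽ C ∫ (|dϕ|² + |ϕ||Δϕ|) |du|^α`, … choosing `ϕ ≡ 1` on `B_r(p)`, `|dϕ| ⩽ C/r`,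
`|Δϕ| ⩽ C/r²`", with the weights supported in `tsupport φ ⊆ Ω`).
[cite: KarpukhinStern2024, Lemma 3.4 p. 749 and proof of Prop. 3.5 pp. 749–750] -/
theorem karpukhinStern_lemma34_cutoff
    {u : N → Metric.sphere (0 : EuclideanSpace ℝ (Fin (k + 1))) 1} (hu : ContMDiff J (𝓡 k) ∞ u)
    (harm : ∀ (i : Fin (k + 1)) (x : N), (ofRiemannian h).dalembertian
      (fun y ↦ (u y : EuclideanSpace ℝ (Fin (k + 1))) i) x =
        -(energyDensity h u x) * (u x : EuclideanSpace ℝ (Fin (k + 1))) i)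
    {K : ℝ} (hK : ∀ (x : N) (v : TangentSpace J x),
      -(K * (ofRiemannian h).val x v v) ≤ (ofRiemannian h).ricci x v v) (hK0 : 0 ≤ K)
    (hm : 2 ≤ m) {α : ℝ} (hα : 2 ≤ α)
    {Ω : Set N} {φ : N → ℝ} (hφ : ContMDiff J 𝓘(ℝ, ℝ) ∞ φ) (hφΩ : tsupport φ ⊆ Ω)
    (hφ1 : ∀ x, |φ x| ≤ 1) {a b : ℝ} (ha : ∀ x, (ofRiemannian h).gradSq φ x ≤ a)
    (hb : ∀ x, |(ofRiemannian h).dalembertian (fun y ↦ φ y ^ 2) x| ≤ b) {M : ℕ}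
    (hind : energyIndexOn h hu Ω ≤ M) (hMk : M + 2 < k) :
    (((k : ℝ) - 2 - M) - ((k : ℝ) - M + 1) *
        (α ^ 2 / (4 * ((m : ℝ) / ((m : ℝ) - 1) + α - 2)) * (((m : ℝ) - 1) / m))) *
        ∫ x, φ x ^ 2 * energyDensity h u x ^ (α / 2 + 1) ∂riemannianMeasure h ≤
      ((k : ℝ) - M + 1) *
        (a + |α ^ 2 / (4 * ((m : ℝ) / ((m : ℝ) - 1) + α - 2)) / α - 1 / 2| * b
          + α ^ 2 / (4 * ((m : ℝ) / ((m : ℝ) - 1) + α - 2)) * K) *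
        ∫ x in Ω, energyDensity h u x ^ (α / 2) ∂riemannianMeasure h := by
  set g := ofRiemannian h with hg
  set e := energyDensity h u with hedef
  set Q : ℝ := α ^ 2 / (4 * ((m : ℝ) / ((m : ℝ) - 1) + α - 2)) with hQ
  have h34 := karpukhinStern_lemma34 h hu harm hK hm hα hφ hφΩ hind hMk
  have he : ContMDiff J 𝓘(ℝ, ℝ) ∞ e := contMDiff_energyDensity h hu
  have hec : Continuous e := he.continuous
  have he0 : ∀ x, 0 ≤ e x := fun x ↦ energyDensity_nonneg' h u x
  have hα2 : 0 ≤ α / 2 := by linarith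
  have heα : Continuous fun x ↦ e x ^ (α / 2) := hec.rpow_const fun x ↦ Or.inr hα2
  have heα0 : ∀ x, 0 ≤ e x ^ (α / 2) := fun x ↦ Real.rpow_nonneg (he0 x) _
  have hkM' : 0 < (k : ℝ) - M + 1 := by
    have : (M : ℝ) + 2 < k := by exact_mod_cast hMk
    linarith
  have hm' : (2 : ℝ) ≤ m := by exact_mod_cast hm
  have hQ0 : 0 ≤ Q := by
    rw [hQ]
    have h1 : 0 < (m : ℝ) / ((m : ℝ) - 1) := div_pos (by linarith) (by linarith)
    have hden : 0 < 4 * ((m : ℝ) / ((m : ℝ) - 1) + α - 2) := by linarith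
    exact div_nonneg (sq_nonneg α) hden.le
  -- off `tsupport φ` the weights vanish
  have hφ0 : ∀ x ∉ Ω, φ x = 0 := fun x hx ↦ image_eq_zero_of_notMem_tsupport fun h' ↦ hx (hφΩ h')
  have hgrad0 : ∀ x ∉ Ω, g.gradSq φ x = 0 := by
    intro x hx
    have hx' : x ∉ tsupport φ := fun h' ↦ hx (hφΩ h')
    simp only [PseudoRiemannianMetric.gradSq, mvfderiv_eq_zero_of_notMem_tsupport hx']
    simp [PseudoRiemannianMetric.innerDual]
  have hlap0 : ∀ x ∉ Ω, g.dalembertian (fun y ↦ φ y ^ 2) x = 0 := by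
    intro x hx
    have hx' : x ∉ tsupport φ := fun h' ↦ hx (hφΩ h')
    have hsq : (fun y ↦ φ y ^ 2) = fun y ↦ φ y * φ y := funext fun y ↦ sq (φ y)
    have hx2 : x ∉ tsupport fun y ↦ φ y ^ 2 := fun h' ↦
      hx' (tsupport_mul_subset_left (f := φ) (g := φ) (hsq ▸ h'))
    exact g.dalembertian_eq_zero_of_notMem_tsupport hx2
  -- the three weights
  have hI1 : |∫ x, g.gradSq φ x * e x ^ (α / 2) ∂riemannianMeasure h| ≤
      a * ∫ x in Ω, e x ^ (α / 2) ∂riemannianMeasure h :=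
    abs_integral_mul_le_mul_setIntegral h (contMDiff_gradSq g hφ).continuous heα heα0
      (fun x ↦ by
        have h0 : 0 ≤ g.gradSq φ x := innerDual_self_nonneg g (isRiemannian_ofRiemannian h) x _
        rw [abs_of_nonneg h0]
        exact ha x) hgrad0
  have hI2 : |∫ x, g.dalembertian (fun y ↦ φ y ^ 2) x * e x ^ (α / 2) ∂riemannianMeasure h| ≤
      b * ∫ x in Ω, e x ^ (α / 2) ∂riemannianMeasure h :=
    abs_integral_mul_le_mul_setIntegral h (contMDiff_dalembertian g (hφ.pow 2)).continuous heα heα0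
      hb hlap0
  have hI3 : |∫ x, φ x ^ 2 * e x ^ (α / 2) ∂riemannianMeasure h| ≤
      1 * ∫ x in Ω, e x ^ (α / 2) ∂riemannianMeasure h :=
    abs_integral_mul_le_mul_setIntegral h (w := fun x ↦ φ x ^ 2) (hφ.continuous.pow 2) heα heα0
      (fun x ↦ by
        rw [abs_of_nonneg (sq_nonneg _), sq_le_one_iff_abs_le_one]
        exact hφ1 x) (fun x hx ↦ by simp only [hφ0 x hx]; ring)
  have hS0 : 0 ≤ ∫ x in Ω, e x ^ (α / 2) ∂riemannianMeasure h := integral_nonneg fun x ↦ heα0 x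
  -- combine
  have h1 := (abs_le.1 hI1).2
  have h2 := abs_le.1 hI2
  have h3 := (abs_le.1 hI3).2
  have hmid : (Q / α - 1 / 2) * ∫ x, g.dalembertian (fun y ↦ φ y ^ 2) x * e x ^ (α / 2)
      ∂riemannianMeasure h ≤ |Q / α - 1 / 2| * (b * ∫ x in Ω, e x ^ (α / 2) ∂riemannianMeasure h) := by
    calc (Q / α - 1 / 2) * ∫ x, g.dalembertian (fun y ↦ φ y ^ 2) x * e x ^ (α / 2) ∂riemannianMeasure h
        ≤ |(Q / α - 1 / 2) * ∫ x, g.dalembertian (fun y ↦ φ y ^ 2) x * e x ^ (α / 2)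
            ∂riemannianMeasure h| := le_abs_self _
      _ = |Q / α - 1 / 2| * |∫ x, g.dalembertian (fun y ↦ φ y ^ 2) x * e x ^ (α / 2)
            ∂riemannianMeasure h| := abs_mul _ _
      _ ≤ |Q / α - 1 / 2| * (b * ∫ x in Ω, e x ^ (α / 2) ∂riemannianMeasure h) :=
          mul_le_mul_of_nonneg_left hI2 (abs_nonneg _)
  have hQK : Q * K * ∫ x, φ x ^ 2 * e x ^ (α / 2) ∂riemannianMeasure h ≤
      Q * K * ∫ x in Ω, e x ^ (α / 2) ∂riemannianMeasure h := by
    refine mul_le_mul_of_nonneg_left ?_ (mul_nonneg hQ0 hK0)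
    linarith
  nlinarith [h34, h1, hmid, hQK, hkM', mul_nonneg hkM'.le hS0]

/-- The numerical constants of Prop. 3.5 (p. 749: "`P(n,2) = (n−1)²/n² ⩽ 16/25`,
`P(n,4) = 4(n−1)²/(n(3n−2)) ⩽ 64/65` for `n ⩽ 5`", so that `200/203 − P > 0`), for `2 ≤ m ≤ 5`.
[cite: KarpukhinStern2024, §3.1 p. 749] -/
theorem prop35_constants_pos (hm2 : 2 ≤ m) (hm5 : m ≤ 5) :
    0 < (200 : ℝ) - 203 * (((m : ℝ) - 1) / m) ^ 2 ∧
      0 < (200 : ℝ) - 203 * (4 * ((m : ℝ) - 1) ^ 2 / ((m : ℝ) * (3 * m - 2))) := by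
  interval_cases m <;> norm_num

/-- The constants `Q(m, 2) = (m−1)/m`, `|Q(m,2)/2 − ½| = 1/(2m)`, `Q(m, 4) = 4(m−1)/(3m−2)`,
`|Q(m,4)/4 − ½| = m/(2(3m−2))`, `P(m, 4) = 4(m−1)²/(m(3m−2))` for `2 ≤ m ≤ 5`.
[cite: KarpukhinStern2024, §3.1 pp. 748–749] -/
theorem prop35_constants_eq (hm2 : 2 ≤ m) (hm5 : m ≤ 5) :
    (2 : ℝ) ^ 2 / (4 * ((m : ℝ) / ((m : ℝ) - 1) + 2 - 2)) = ((m : ℝ) - 1) / m ∧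
      |((m : ℝ) - 1) / m / 2 - 1 / 2| = 1 / (2 * m) ∧
      (4 : ℝ) ^ 2 / (4 * ((m : ℝ) / ((m : ℝ) - 1) + 4 - 2)) = 4 * ((m : ℝ) - 1) / (3 * m - 2) ∧
      |4 * ((m : ℝ) - 1) / (3 * m - 2) / 4 - 1 / 2| = (m : ℝ) / (2 * (3 * m - 2)) ∧
      4 * ((m : ℝ) - 1) / (3 * m - 2) * (((m : ℝ) - 1) / m) =
        4 * ((m : ℝ) - 1) ^ 2 / ((m : ℝ) * (3 * m - 2)) := by
  interval_cases m <;> norm_num [abs_of_nonneg, abs_of_nonpos]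

/-- **Karpukhin–Stern, Proposition 3.5 (the analytic core, pp. 749–750).** Let `u : N → Sᵏ` be a
smooth harmonic map on a closed Riemannian manifold of dimension `2 ≤ m ≤ 5` with `Ric ≥ −K h`,
`K ≥ 0`, and let `S₁ ⊆ Ω₂ ⊆ Ω₃` (in print `B_{r/2}(p) ⊆ B_r(p) ⊆ B_{2r}(p)`) with
`ind_E(u; Ω₃) ≤ k − 2 − 200`, `k ≥ 202`. Given smooth cut-offs `φ₁` (`= 1` on `Ω₂`,
`tsupport φ₁ ⊆ Ω₃`) and `φ₂` (`= 1` on `S₁`, `tsupport φ₂ ⊆ Ω₂`) with `|φᵢ| ≤ 1`,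
`|dφᵢ|² ≤ aᵢ`, `|tr Hess(φᵢ²)| ≤ bᵢ`, we get, with `e = |du|²`,

  `∫_{S₁} e³ ≤ C₄ · C₂ · ∫_{Ω₃} e`,
  `C₂ = 203 (a₁ + b₁/(2m) + ((m−1)/m) K) / (200 − 203 P(m,2))`,
  `C₄ = 203 (a₂ + (m/(2(3m−2))) b₂ + (4(m−1)/(3m−2)) K) / (200 − 203 P(m,4))`,

i.e. `‖du‖⁶_{L⁶(B_{r/2})} ≤ C r⁻⁴ ‖du‖²_{L²(B_{2r})}` once `aᵢ, bᵢ ≲ r⁻²` — exactly the printed two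
applications of Lemma 3.4 (`α = 2` on `Ω₃` giving (3.4) `∫_{B_r}|du|⁴ ≤ C r⁻² ∫_{B_{2r}}|du|²`, then
`α = 4` on `Ω₂`), via `karpukhinStern_lemma34_cutoff`, `energyIndexOn_mono` and
`prop35_constants_pos`. The cut-offs are hypotheses here (on geodesic balls they are provided by
`exists_metric_cutoff` of `MetricCutoff.lean` and compactness).
[cite: KarpukhinStern2024, Prop. 3.5 pp. 749–750] -/
theorem karpukhinStern_prop35_core
    {u : N → Metric.sphere (0 : EuclideanSpace ℝ (Fin (k + 1))) 1} (hu : ContMDiff J (𝓡 k) ∞ u)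
    (harm : ∀ (i : Fin (k + 1)) (x : N), (ofRiemannian h).dalembertian
      (fun y ↦ (u y : EuclideanSpace ℝ (Fin (k + 1))) i) x =
        -(energyDensity h u x) * (u x : EuclideanSpace ℝ (Fin (k + 1))) i)
    {K : ℝ} (hK : ∀ (x : N) (v : TangentSpace J x),
      -(K * (ofRiemannian h).val x v v) ≤ (ofRiemannian h).ricci x v v) (hK0 : 0 ≤ K)
    (hm2 : 2 ≤ m) (hm5 : m ≤ 5)
    {S₁ Ω₂ Ω₃ : Set N} (hS₁ : MeasurableSet S₁) (hΩ₂ : MeasurableSet Ω₂) (h23 : Ω₂ ⊆ Ω₃)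
    {φ₁ : N → ℝ} (hφ₁ : ContMDiff J 𝓘(ℝ, ℝ) ∞ φ₁) (hφ₁Ω : tsupport φ₁ ⊆ Ω₃)
    (hφ₁one : ∀ x ∈ Ω₂, φ₁ x = 1) (hφ₁le : ∀ x, |φ₁ x| ≤ 1) {a₁ b₁ : ℝ}
    (ha₁ : ∀ x, (ofRiemannian h).gradSq φ₁ x ≤ a₁)
    (hb₁ : ∀ x, |(ofRiemannian h).dalembertian (fun y ↦ φ₁ y ^ 2) x| ≤ b₁)
    {φ₂ : N → ℝ} (hφ₂ : ContMDiff J 𝓘(ℝ, ℝ) ∞ φ₂) (hφ₂Ω : tsupport φ₂ ⊆ Ω₂)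
    (hφ₂one : ∀ x ∈ S₁, φ₂ x = 1) (hφ₂le : ∀ x, |φ₂ x| ≤ 1) {a₂ b₂ : ℝ}
    (ha₂ : ∀ x, (ofRiemannian h).gradSq φ₂ x ≤ a₂)
    (hb₂ : ∀ x, |(ofRiemannian h).dalembertian (fun y ↦ φ₂ y ^ 2) x| ≤ b₂)
    (hk : 202 ≤ k) (hind : energyIndexOn h hu Ω₃ ≤ (k - 202 : ℕ)) :
    ∫ x in S₁, energyDensity h u x ^ 3 ∂riemannianMeasure h ≤
      (203 * (a₂ + (m : ℝ) / (2 * (3 * m - 2)) * b₂ + 4 * ((m : ℝ) - 1) / (3 * m - 2) * K) /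
          (200 - 203 * (4 * ((m : ℝ) - 1) ^ 2 / ((m : ℝ) * (3 * m - 2))))) *
        ((203 * (a₁ + b₁ / (2 * m) + ((m : ℝ) - 1) / m * K) /
            (200 - 203 * (((m : ℝ) - 1) / m) ^ 2)) *
          ∫ x in Ω₃, energyDensity h u x ∂riemannianMeasure h) := by
  set e := energyDensity h u with hedef
  have he : ContMDiff J 𝓘(ℝ, ℝ) ∞ e := contMDiff_energyDensity h hu
  have hec : Continuous e := he.continuous
  have he0 : ∀ x, 0 ≤ e x := fun x ↦ energyDensity_nonneg' h u x
  obtain ⟨hD₂, hD₄⟩ := prop35_constants_pos (m := m) hm2 hm5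
  have hm' : (2 : ℝ) ≤ m := by exact_mod_cast hm2
  -- the index hypotheses with `M = k − 202`
  set M : ℕ := k - 202 with hMdef
  have hMk : M + 2 < k := by omega
  have hM : ((M : ℕ) : ℝ) = (k : ℝ) - 202 := by
    rw [hMdef, Nat.cast_sub hk]
    norm_num
  have h200 : (k : ℝ) - 2 - M = 200 := by rw [hM]; ring
  have h203 : (k : ℝ) - M + 1 = 203 := by rw [hM]; ring
  have hind₂ : energyIndexOn h hu Ω₂ ≤ M := (energyIndexOn_mono h hu h23).trans hind
  obtain ⟨eQ₂, ec₂, eQ₄, ec₄, eP₄⟩ := prop35_constants_eq (m := m) hm2 hm5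
  -- Step A: `α = 2` on `Ω₃`
  have hA := karpukhinStern_lemma34_cutoff h hu harm hK hK0 hm2 (α := 2) le_rfl hφ₁ hφ₁Ω hφ₁le
    ha₁ hb₁ hind hMk
  rw [h200, h203, eQ₂, ec₂] at hA
  have eP₂ : ((m : ℝ) - 1) / m * (((m : ℝ) - 1) / m) = (((m : ℝ) - 1) / m) ^ 2 := by ring
  have eb₁ : 1 / (2 * (m : ℝ)) * b₁ = b₁ / (2 * m) := by ring
  rw [eP₂, eb₁] at hA
  have hpowA : ∀ t : ℝ, t ^ ((2 : ℝ) / 2 + 1) = t ^ 2 := fun t ↦ by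
    rw [show (2 : ℝ) / 2 + 1 = 2 by norm_num, Real.rpow_two]
  have hpowA' : ∀ t : ℝ, t ^ ((2 : ℝ) / 2) = t := fun t ↦ by
    rw [show (2 : ℝ) / 2 = 1 by norm_num, Real.rpow_one]
  simp_rw [hpowA, hpowA'] at hA
  -- Step B: `α = 4` on `Ω₂`
  have hB := karpukhinStern_lemma34_cutoff h hu harm hK hK0 hm2 (α := 4) (by norm_num) hφ₂ hφ₂Ω
    hφ₂le ha₂ hb₂ hind₂ hMk
  rw [h200, h203, eQ₄, ec₄, eP₄] at hB
  have hpowB : ∀ t : ℝ, t ^ ((4 : ℝ) / 2 + 1) = t ^ 3 := fun t ↦ by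
    rw [show (4 : ℝ) / 2 + 1 = 3 by norm_num, Real.rpow_ofNat]
  have hpowB' : ∀ t : ℝ, t ^ ((4 : ℝ) / 2) = t ^ 2 := fun t ↦ by
    rw [show (4 : ℝ) / 2 = 2 by norm_num, Real.rpow_two]
  simp_rw [hpowB, hpowB'] at hB
  -- set-integral comparisons
  have hI3 : Integrable (fun x ↦ φ₂ x ^ 2 * e x ^ 3) (riemannianMeasure h) :=
    integrable_of_continuous h ((hφ₂.continuous.pow 2).mul (hec.pow 3))
  have hI2 : Integrable (fun x ↦ φ₁ x ^ 2 * e x ^ 2) (riemannianMeasure h) :=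
    integrable_of_continuous h ((hφ₁.continuous.pow 2).mul (hec.pow 2))
  have hS : ∫ x in S₁, e x ^ 3 ∂riemannianMeasure h ≤ ∫ x, φ₂ x ^ 2 * e x ^ 3 ∂riemannianMeasure h := by
    have h1 : ∫ x in S₁, e x ^ 3 ∂riemannianMeasure h = ∫ x in S₁, φ₂ x ^ 2 * e x ^ 3 ∂riemannianMeasure h :=
      setIntegral_congr_fun hS₁ fun x hx ↦ by rw [hφ₂one x hx]; ring
    rw [h1]
    exact setIntegral_le_integral hI3 (Eventually.of_forall fun x ↦
      mul_nonneg (sq_nonneg _) (pow_nonneg (he0 x) 3))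
  have hΩ : ∫ x in Ω₂, e x ^ 2 ∂riemannianMeasure h ≤ ∫ x, φ₁ x ^ 2 * e x ^ 2 ∂riemannianMeasure h := by
    have h1 : ∫ x in Ω₂, e x ^ 2 ∂riemannianMeasure h = ∫ x in Ω₂, φ₁ x ^ 2 * e x ^ 2 ∂riemannianMeasure h :=
      setIntegral_congr_fun hΩ₂ fun x hx ↦ by rw [hφ₁one x hx]; ring
    rw [h1]
    exact setIntegral_le_integral hI2 (Eventually.of_forall fun x ↦
      mul_nonneg (sq_nonneg _) (pow_nonneg (he0 x) 2))
  -- positivity of the constants' numerators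
  have hm0 : (0 : ℝ) < m := by linarith
  have h3m : (0 : ℝ) < 3 * m - 2 := by linarith
  rcases isEmpty_or_nonempty N with hN | hN
  · have h1 : S₁ = ∅ := Set.eq_empty_of_isEmpty S₁
    have h2 : Ω₃ = ∅ := Set.eq_empty_of_isEmpty Ω₃
    rw [h1, h2, Measure.restrict_empty, integral_zero_measure, integral_zero_measure]
    simp
  obtain ⟨x₀⟩ := hN
  have ha₁0 : 0 ≤ a₁ :=
    (innerDual_self_nonneg (ofRiemannian h) (isRiemannian_ofRiemannian h) x₀ _).trans (ha₁ x₀)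
  have ha₂0 : 0 ≤ a₂ :=
    (innerDual_self_nonneg (ofRiemannian h) (isRiemannian_ofRiemannian h) x₀ _).trans (ha₂ x₀)
  have hb₁0 : 0 ≤ b₁ := (abs_nonneg _).trans (hb₁ x₀)
  have hb₂0 : 0 ≤ b₂ := (abs_nonneg _).trans (hb₂ x₀)
  have hc₂ : 0 ≤ a₁ + b₁ / (2 * m) + ((m : ℝ) - 1) / m * K := by
    have : 0 ≤ ((m : ℝ) - 1) / m := div_nonneg (by linarith) hm0.le
    positivity
  have hc₄ : 0 ≤ a₂ + (m : ℝ) / (2 * (3 * m - 2)) * b₂ + 4 * ((m : ℝ) - 1) / (3 * m - 2) * K := by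
    have : 0 ≤ 4 * ((m : ℝ) - 1) / (3 * m - 2) := div_nonneg (by linarith) h3m.le
    positivity
  have hI₃0 : 0 ≤ ∫ x in Ω₃, e x ∂riemannianMeasure h := integral_nonneg fun x ↦ he0 x
  have hX₂ : ∫ x, φ₁ x ^ 2 * e x ^ 2 ∂riemannianMeasure h ≤
      203 * (a₁ + b₁ / (2 * m) + ((m : ℝ) - 1) / m * K) / (200 - 203 * (((m : ℝ) - 1) / m) ^ 2) *
        ∫ x in Ω₃, e x ∂riemannianMeasure h := by
    rw [div_mul_eq_mul_div, le_div_iff₀ hD₂]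
    linarith
  have hX₃ : ∫ x, φ₂ x ^ 2 * e x ^ 3 ∂riemannianMeasure h ≤
      203 * (a₂ + (m : ℝ) / (2 * (3 * m - 2)) * b₂ + 4 * ((m : ℝ) - 1) / (3 * m - 2) * K) /
          (200 - 203 * (4 * ((m : ℝ) - 1) ^ 2 / ((m : ℝ) * (3 * m - 2)))) *
        ∫ x in Ω₂, e x ^ 2 ∂riemannianMeasure h := by
    rw [div_mul_eq_mul_div, le_div_iff₀ hD₄]
    linarith
  have hC₄0 : 0 ≤ 203 * (a₂ + (m : ℝ) / (2 * (3 * m - 2)) * b₂ + 4 * ((m : ℝ) - 1) / (3 * m - 2) * K) /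
      (200 - 203 * (4 * ((m : ℝ) - 1) ^ 2 / ((m : ℝ) * (3 * m - 2)))) :=
    div_nonneg (by positivity) hD₄.le
  calc ∫ x in S₁, e x ^ 3 ∂riemannianMeasure h
      ≤ ∫ x, φ₂ x ^ 2 * e x ^ 3 ∂riemannianMeasure h := hS
    _ ≤ _ := hX₃
    _ ≤ 203 * (a₂ + (m : ℝ) / (2 * (3 * m - 2)) * b₂ + 4 * ((m : ℝ) - 1) / (3 * m - 2) * K) /
          (200 - 203 * (4 * ((m : ℝ) - 1) ^ 2 / ((m : ℝ) * (3 * m - 2)))) *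
        ∫ x, φ₁ x ^ 2 * e x ^ 2 ∂riemannianMeasure h := mul_le_mul_of_nonneg_left hΩ hC₄0
    _ ≤ _ := mul_le_mul_of_nonneg_left hX₂ hC₄0

end Prop35

/-! ### Part G — toward Lemmas 3.6–3.7 and Prop. 5.5: hemispheres, (3.9), additivity of the local index -/

section IndexAdditivity

variable {V U₁ U₂ : Type*} [AddCommGroup V] [Module ℝ V] [AddCommGroup U₁] [Module ℝ U₁]
  [AddCommGroup U₂] [Module ℝ U₂]

/-- **Super-additivity of the index over `Q`-orthogonal pieces with trivial intersection.** If
`T₁ : U₁ → V`, `T₂ : U₂ → V` are injective linear maps with disjoint ranges and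
`Q(T₁a + T₂b) = Q(T₁a) + Q(T₂b)`, then `ind(Q ∘ T₁) + ind(Q ∘ T₂) ≤ ind Q` (the sum of a
negative definite subspace for `Q ∘ T₁` and one for `Q ∘ T₂`, pushed into `V`, is negative
definite of the summed dimension). Karpukhin–Stern p. 752: "Since `M ∖ B_δ(p)` and `B_δ(p)` are
disjoint, `ind_E(u; B_δ(p)) + ind_E(u; M ∖ B_δ(p)) ⩽ ind_E(u; M)`".
[cite: KarpukhinStern2024, proof of Lemma 3.7 p. 752] -/
theorem negIndex_comp_add_negIndex_comp_le (Q : QuadraticMap ℝ V ℝ) (T₁ : U₁ →ₗ[ℝ] V)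
    (T₂ : U₂ →ₗ[ℝ] V) (h₁ : Function.Injective T₁) (h₂ : Function.Injective T₂)
    (hdisj : Disjoint (LinearMap.range T₁) (LinearMap.range T₂))
    (hadd : ∀ a b, Q (T₁ a + T₂ b) = Q (T₁ a) + Q (T₂ b)) :
    negIndex (Q.comp T₁) + negIndex (Q.comp T₂) ≤ negIndex Q := by
  haveI : Nonempty {S : Submodule ℝ U₁ // FiniteDimensional ℝ S ∧ ∀ v ∈ S, v ≠ 0 → Q.comp T₁ v < 0} :=
    ⟨⟨⊥, inferInstance, fun v hv hv0 ↦ absurd ((Submodule.mem_bot ℝ).1 hv) hv0⟩⟩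
  haveI : Nonempty {S : Submodule ℝ U₂ // FiniteDimensional ℝ S ∧ ∀ v ∈ S, v ≠ 0 → Q.comp T₂ v < 0} :=
    ⟨⟨⊥, inferInstance, fun v hv hv0 ↦ absurd ((Submodule.mem_bot ℝ).1 hv) hv0⟩⟩
  unfold negIndex
  refine ENat.iSup_add_iSup_le fun S₁ S₂ ↦ ?_
  obtain ⟨S₁, hS₁fin, hS₁⟩ := S₁
  obtain ⟨S₂, hS₂fin, hS₂⟩ := S₂
  -- push the two subspaces into `V`
  set P₁ : Submodule ℝ V := S₁.map T₁ with hP₁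
  set P₂ : Submodule ℝ V := S₂.map T₂ with hP₂
  have hfr₁ : finrank ℝ P₁ = finrank ℝ S₁ :=
    (LinearEquiv.finrank_eq (Submodule.equivMapOfInjective T₁ h₁ S₁)).symm
  have hfr₂ : finrank ℝ P₂ = finrank ℝ S₂ :=
    (LinearEquiv.finrank_eq (Submodule.equivMapOfInjective T₂ h₂ S₂)).symm
  haveI : FiniteDimensional ℝ P₁ := Module.Finite.map S₁ T₁
  haveI : FiniteDimensional ℝ P₂ := Module.Finite.map S₂ T₂
  have hle₁ : P₁ ≤ LinearMap.range T₁ := LinearMap.map_le_range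
  have hle₂ : P₂ ≤ LinearMap.range T₂ := LinearMap.map_le_range
  have hinf : P₁ ⊓ P₂ = ⊥ := disjoint_iff.1 (hdisj.mono hle₁ hle₂)
  have hdim : finrank ℝ ↥(P₁ ⊔ P₂) = finrank ℝ S₁ + finrank ℝ S₂ := by
    have h := Submodule.finrank_sup_add_finrank_inf_eq P₁ P₂
    rw [hinf, finrank_bot, add_zero, hfr₁, hfr₂] at h
    exact h
  -- `Q` is negative definite on `P₁ ⊔ P₂`
  have hneg : ∀ w ∈ P₁ ⊔ P₂, w ≠ 0 → Q w < 0 := by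
    intro w hw hw0
    obtain ⟨v, hv, z, hz, rfl⟩ := Submodule.mem_sup.1 hw
    obtain ⟨a, ha, rfl⟩ := Submodule.mem_map.1 hv
    obtain ⟨b, hb, rfl⟩ := Submodule.mem_map.1 hz
    rw [hadd a b]
    have hQa : Q (T₁ a) ≤ 0 := by
      by_cases ha0 : a = 0
      · rw [ha0, map_zero, map_zero]
      · exact (hS₁ a ha ha0).le
    have hQb : Q (T₂ b) ≤ 0 := by
      by_cases hb0 : b = 0
      · rw [hb0, map_zero, map_zero]
      · exact (hS₂ b hb hb0).le
    by_cases ha0 : a = 0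
    · have hb0 : b ≠ 0 := by
        rintro rfl
        apply hw0
        rw [ha0, map_zero, map_zero, add_zero]
      have := hS₂ b hb hb0
      change Q (T₂ b) < 0 at this
      linarith
    · have := hS₁ a ha ha0
      change Q (T₁ a) < 0 at this
      linarith
  have key := finrank_le_negIndex (Q := Q) (P₁ ⊔ P₂) hneg
  rw [hdim] at key
  exact_mod_cast key

end IndexAdditivity

section Hemisphere

open Lorentzian Lorentzian.PseudoRiemannianMetric Bundle Filter Topology
open _root_.MeasureTheory

variable {m : ℕ} {H' : Type*} [TopologicalSpace H']
  {J : ModelWithCorners ℝ (EuclideanSpace ℝ (Fin m)) H'} [J.Boundaryless]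
  {N : Type*} [TopologicalSpace N] [ChartedSpace H' N] [IsManifold J ∞ N] [CompactSpace N]
  [T2Space N] [MeasurableSpace N] [BorelSpace N]
  (h : ContMDiffRiemannianMetric J ∞ (EuclideanSpace ℝ (Fin m)) (TangentSpace J : N → Type _))
  [(ofRiemannian h).HasLeviCivita] {k : ℕ}

/-- **A harmonic map into an open hemisphere is constant** (the last step of Karpukhin–Stern's
proof of Prop. 5.5, p. 776: "if `⟨u(x), e₀⟩ > ½`, integrating the harmonic map equation
`Δu = |du|²u` against the constant vector `e₀` gives `0 = ∫ |du|²⟨u, e₀⟩ ⩾ ½ ∫ |du|²`"): if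
`u : N → Sᵏ` is smooth harmonic on the closed manifold `N` and `⟨u(x), a⟩ > 0` for all `x`, then
`|du|²_h ≡ 0`. [cite: KarpukhinStern2024, proof of Prop. 5.5 p. 776] -/
theorem energyDensity_eq_zero_of_sphereComp_pos
    {u : N → Metric.sphere (0 : EuclideanSpace ℝ (Fin (k + 1))) 1} (hu : ContMDiff J (𝓡 k) ∞ u)
    (harm : ∀ (i : Fin (k + 1)) (x : N), (ofRiemannian h).dalembertian
      (fun y ↦ (u y : EuclideanSpace ℝ (Fin (k + 1))) i) x =
        -(energyDensity h u x) * (u x : EuclideanSpace ℝ (Fin (k + 1))) i)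
    {a : EuclideanSpace ℝ (Fin (k + 1))} (hpos : ∀ x, 0 < sphereComp u a x) (x : N) :
    energyDensity h u x = 0 := by
  set e := energyDensity h u with hedef
  set f := sphereComp u a with hfdef
  have hf : ContMDiff J 𝓘(ℝ, ℝ) ∞ f := contMDiff_sphereComp hu a
  have hec : Continuous e := (contMDiff_energyDensity h hu).continuous
  have he0 : ∀ y, 0 ≤ e y := fun y ↦ energyDensity_nonneg' h u y
  -- `□ f = −e f`
  have hLap : ∀ y, (ofRiemannian h).dalembertian f y = -(e y * f y) := by
    intro y
    rw [hfdef, dalembertian_sphereComp h hu a y]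
    simp only [harm, sphereComp, Finset.mul_sum]
    rw [← Finset.sum_neg_distrib]
    refine Finset.sum_congr rfl fun i _ ↦ ?_
    ring
  -- `∫ e f = 0`
  have hint : ∫ y, e y * f y ∂riemannianMeasure h = 0 := by
    have h0 := integral_dalembertian_eq_zero h (f := f) (hf.of_le (WithTop.coe_le_coe.mpr le_top))
    simp_rw [hLap, integral_neg, neg_eq_zero] at h0
    exact h0
  -- hence `e f ≡ 0`
  have hnn : ∀ y, 0 ≤ e y * f y := fun y ↦ mul_nonneg (he0 y) (hpos y).le
  have hcont : Continuous fun y ↦ e y * f y := hec.mul hf.continuous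
  have hae : (fun y ↦ e y * f y) =ᵐ[riemannianMeasure h] 0 :=
    (integral_eq_zero_iff_of_nonneg (fun y ↦ hnn y) (integrable_of_continuous h hcont)).1 hint
  haveI := isOpenPosMeasure_riemannianMeasure h
  have hzero : (fun y ↦ e y * f y) = 0 := (hcont.ae_eq_iff_eq (riemannianMeasure h) continuous_const).1 hae
  have hx := congrFun hzero x
  simp only [Pi.zero_apply, mul_eq_zero] at hx
  rcases hx with hx | hx
  · exact hx
  · exact absurd hx (hpos x).ne'

/-- Hence such a map is constant on a connected `N` (every coordinate has vanishing differential).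
[cite: KarpukhinStern2024, proof of Prop. 5.5 p. 776] -/
theorem apply_eq_of_sphereComp_pos [ConnectedSpace N]
    {u : N → Metric.sphere (0 : EuclideanSpace ℝ (Fin (k + 1))) 1} (hu : ContMDiff J (𝓡 k) ∞ u)
    (harm : ∀ (i : Fin (k + 1)) (x : N), (ofRiemannian h).dalembertian
      (fun y ↦ (u y : EuclideanSpace ℝ (Fin (k + 1))) i) x =
        -(energyDensity h u x) * (u x : EuclideanSpace ℝ (Fin (k + 1))) i)
    {a : EuclideanSpace ℝ (Fin (k + 1))} (hpos : ∀ x, 0 < sphereComp u a x) (x y : N) :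
    u x = u y := by
  have he := energyDensity_eq_zero_of_sphereComp_pos h hu harm hpos
  apply Subtype.ext
  ext i
  refine apply_eq_of_mfderiv_eq_zero ((contMDiff_sphereCoord hu i).of_le (by exact_mod_cast le_top))
    (fun z ↦ ?_) x y
  -- each term of the energy density vanishes at `z`
  have hterm : (ofRiemannian h).innerDual z
      (mvfderiv J (fun w ↦ (u w : EuclideanSpace ℝ (Fin (k + 1))) i) z).toLinearMap
      (mvfderiv J (fun w ↦ (u w : EuclideanSpace ℝ (Fin (k + 1))) i) z).toLinearMap = 0 := by
    have hsum := he z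
    unfold energyDensity at hsum
    exact (Finset.sum_eq_zero_iff_of_nonneg (fun j _ ↦ innerDual_self_nonneg h z _)).1 hsum i
      (Finset.mem_univ i)
  by_contra hne
  have hpos' : 0 < (ofRiemannian h).innerDual z
      (mvfderiv J (fun w ↦ (u w : EuclideanSpace ℝ (Fin (k + 1))) i) z).toLinearMap
      (mvfderiv J (fun w ↦ (u w : EuclideanSpace ℝ (Fin (k + 1))) i) z).toLinearMap := by
    refine innerDual_self_pos h fun h0 ↦ hne ?_
    ext v
    have := congr_arg (fun L : TangentSpace J z →ₗ[ℝ] ℝ ↦ L v) h0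
    simpa [mvfderiv] using this
  exact hpos'.ne' hterm

/-- **The `W^{1,2}` bound (3.9) from (3.3)** (Karpukhin–Stern p. 752: "we can simply integrate
(3.3) against `|du|²` to see that `∫ |d|du|²|² ⩽ C ∫ (|du|⁴ + |du|⁶)`"): for a smooth harmonic
`u : N → Sᵏ` on a closed manifold with `Ric ≥ −K h` and `e = |du|²_h`,
`(3m − 2) ∫ h⁻¹(de, de) ≤ 2(m − 1)(2K ∫ e² + (2 − 2/m) ∫ e³)` — integrate
`kato_bochner_energyDensity` and use Green's identity `∫ e tr Hess e = −∫ h⁻¹(de, de)`.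
[cite: KarpukhinStern2024, (3.9) p. 752] -/
theorem integral_gradSq_energyDensity_le
    {u : N → Metric.sphere (0 : EuclideanSpace ℝ (Fin (k + 1))) 1} (hu : ContMDiff J (𝓡 k) ∞ u)
    (harm : ∀ (i : Fin (k + 1)) (x : N), (ofRiemannian h).dalembertian
      (fun y ↦ (u y : EuclideanSpace ℝ (Fin (k + 1))) i) x =
        -(energyDensity h u x) * (u x : EuclideanSpace ℝ (Fin (k + 1))) i)
    {K : ℝ} (hK : ∀ (x : N) (v : TangentSpace J x),
      -(K * (ofRiemannian h).val x v v) ≤ (ofRiemannian h).ricci x v v) :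
    (3 * (m : ℝ) - 2) * ∫ x, (ofRiemannian h).gradSq (energyDensity h u) x ∂riemannianMeasure h ≤
      2 * ((m : ℝ) - 1) * (2 * K * ∫ x, energyDensity h u x ^ 2 ∂riemannianMeasure h
        + (2 - 2 / m) * ∫ x, energyDensity h u x ^ 3 ∂riemannianMeasure h) := by
  set g := ofRiemannian h with hg
  set e := energyDensity h u with hedef
  have he : ContMDiff J 𝓘(ℝ, ℝ) ∞ e := contMDiff_energyDensity h hu
  have hec : Continuous e := he.continuous
  have hpt : ∀ x, (m : ℝ) * g.gradSq e x ≤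
      2 * ((m : ℝ) - 1) * (e x * g.dalembertian e x) + 2 * ((m : ℝ) - 1) * (2 * K) * e x ^ 2
        + 2 * ((m : ℝ) - 1) * (2 - 2 / m) * e x ^ 3 := by
    intro x
    have h1 := (kato_bochner_energyDensity h hu harm hK x).2
    nlinarith [h1]
  have hI0 : Integrable (fun x ↦ g.gradSq e x) (riemannianMeasure h) :=
    integrable_of_continuous h (contMDiff_gradSq g he).continuous
  have hI1 : Integrable (fun x ↦ e x * g.dalembertian e x) (riemannianMeasure h) :=
    integrable_of_continuous h (hec.mul (contMDiff_dalembertian g he).continuous)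
  have hI2 : Integrable (fun x ↦ e x ^ 2) (riemannianMeasure h) := integrable_of_continuous h (hec.pow 2)
  have hI3 : Integrable (fun x ↦ e x ^ 3) (riemannianMeasure h) := integrable_of_continuous h (hec.pow 3)
  have hGreen : ∫ x, e x * g.dalembertian e x ∂riemannianMeasure h =
      -∫ x, g.gradSq e x ∂riemannianMeasure h :=
    integral_mul_dalembertian_eq_neg_integral_innerDual h (he.of_le (by exact_mod_cast le_top))
      (he.of_le (WithTop.coe_le_coe.mpr le_top))
  have hI12 : Integrable (fun x ↦ 2 * ((m : ℝ) - 1) * (e x * g.dalembertian e x)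
      + 2 * ((m : ℝ) - 1) * (2 * K) * e x ^ 2) (riemannianMeasure h) :=
    (hI1.const_mul _).add (hI2.const_mul _)
  have hI123 : Integrable (fun x ↦ 2 * ((m : ℝ) - 1) * (e x * g.dalembertian e x)
      + 2 * ((m : ℝ) - 1) * (2 * K) * e x ^ 2 + 2 * ((m : ℝ) - 1) * (2 - 2 / m) * e x ^ 3)
      (riemannianMeasure h) := hI12.add (hI3.const_mul _)
  have hI0' : Integrable (fun x ↦ (m : ℝ) * g.gradSq e x) (riemannianMeasure h) := hI0.const_mul _
  have hI1' : Integrable (fun x ↦ 2 * ((m : ℝ) - 1) * (e x * g.dalembertian e x))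
      (riemannianMeasure h) := hI1.const_mul _
  have hI2' : Integrable (fun x ↦ 2 * ((m : ℝ) - 1) * (2 * K) * e x ^ 2) (riemannianMeasure h) :=
    hI2.const_mul _
  have hI3' : Integrable (fun x ↦ 2 * ((m : ℝ) - 1) * (2 - 2 / m) * e x ^ 3) (riemannianMeasure h) :=
    hI3.const_mul _
  have hint := integral_mono hI0' hI123 hpt
  rw [integral_const_mul, integral_add hI12 hI3', integral_add hI1' hI2', integral_const_mul,
    integral_const_mul, integral_const_mul, hGreen] at hint
  nlinarith [hint]

omit [(ofRiemannian h).HasLeviCivita] in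
/-- **Additivity of the local index over disjoint domains** (p. 752): for disjoint `Ω₁, Ω₂`,
`ind_E(u; Ω₁) + ind_E(u; Ω₂) ≤ ind_E(u)` — sections with disjoint supports are `E″(u)`-orthogonal
(the integrand of `E″(u)(v + w)` is that of `v` plus that of `w` pointwise).
[cite: KarpukhinStern2024, proof of Lemma 3.7 p. 752] -/
theorem energyIndexOn_add_le {u : N → Metric.sphere (0 : EuclideanSpace ℝ (Fin (k + 1))) 1}
    (hu : ContMDiff J (𝓡 k) ∞ u) {Ω₁ Ω₂ : Set N} (hdisj : Disjoint Ω₁ Ω₂) :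
    energyIndexOn h hu Ω₁ + energyIndexOn h hu Ω₂ ≤ energyIndex h hu := by
  set T₁ := Submodule.inclusion (tangentSectionsOn_le (J := J) u Ω₁) with hT₁
  set T₂ := Submodule.inclusion (tangentSectionsOn_le (J := J) u Ω₂) with hT₂
  have h₁ : Function.Injective T₁ := Submodule.inclusion_injective _
  have h₂ : Function.Injective T₂ := Submodule.inclusion_injective _
  -- sections supported in disjoint sets: one of them vanishes near each point
  have hvan : ∀ (v : tangentSectionsOn J u Ω₁) (w : tangentSectionsOn J u Ω₂) (x : N),
      (v : N → EuclideanSpace ℝ (Fin (k + 1))) =ᶠ[𝓝 x] 0 ∨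
        (w : N → EuclideanSpace ℝ (Fin (k + 1))) =ᶠ[𝓝 x] 0 := by
    intro v w x
    by_cases hx : x ∈ tsupport (v : N → EuclideanSpace ℝ (Fin (k + 1)))
    · right
      have hx2 : x ∉ tsupport (w : N → EuclideanSpace ℝ (Fin (k + 1))) := fun hx' ↦
        Set.disjoint_left.1 hdisj (v.2.2 hx) (w.2.2 hx')
      exact notMem_tsupport_iff_eventuallyEq.1 hx2
    · left
      exact notMem_tsupport_iff_eventuallyEq.1 hx
  -- disjoint ranges
  have hdisjR : Disjoint (LinearMap.range T₁) (LinearMap.range T₂) := by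
    rw [Submodule.disjoint_def]
    intro z hz₁ hz₂
    obtain ⟨v, rfl⟩ := LinearMap.mem_range.1 hz₁
    obtain ⟨w, hw⟩ := LinearMap.mem_range.1 hz₂
    apply Subtype.ext
    funext x
    have hvw : (v : N → EuclideanSpace ℝ (Fin (k + 1))) = (w : N → EuclideanSpace ℝ (Fin (k + 1))) := by
      have := congrArg (fun s : tangentSections J u ↦ (s : N → EuclideanSpace ℝ (Fin (k + 1)))) hw
      exact this.symm
    rcases hvan v w x with hv | hw'
    · exact hv.eq_of_nhds
    · change (v : N → EuclideanSpace ℝ (Fin (k + 1))) x = 0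
      rw [hvw]
      exact hw'.eq_of_nhds
  -- additivity of `E″(u)`
  have hadd : ∀ (v : tangentSectionsOn J u Ω₁) (w : tangentSectionsOn J u Ω₂),
      secondVariation h hu (T₁ v + T₂ w) = secondVariation h hu (T₁ v) + secondVariation h hu (T₂ w) := by
    intro v w
    rw [secondVariation_eq_integral, secondVariation_eq_integral, secondVariation_eq_integral,
      ← integral_add]
    · refine integral_congr_ae (Eventually.of_forall fun x ↦ ?_)
      dsimp only
      rw [← Finset.sum_add_distrib]
      refine Finset.sum_congr rfl fun i _ ↦ ?_
      have hcoe : ((T₁ v + T₂ w : tangentSections J u) : N → EuclideanSpace ℝ (Fin (k + 1))) =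
          (v : N → EuclideanSpace ℝ (Fin (k + 1))) + (w : N → EuclideanSpace ℝ (Fin (k + 1))) := rfl
      rcases hvan v w x with hv | hw
      · -- `v = 0` near `x`
        have hvi : (fun y ↦ (v : N → EuclideanSpace ℝ (Fin (k + 1))) y i) =ᶠ[𝓝 x] fun _ ↦ 0 :=
          hv.mono fun y hy ↦ by simp [hy]
        have hsum : (fun y ↦ ((T₁ v + T₂ w : tangentSections J u) : N → EuclideanSpace ℝ (Fin (k + 1))) y i)
            =ᶠ[𝓝 x] fun y ↦ (w : N → EuclideanSpace ℝ (Fin (k + 1))) y i := by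
          rw [hcoe]
          exact hv.mono fun y hy ↦ by simp [hy]
        have hd1 : mvfderiv J (fun y ↦ ((T₁ v + T₂ w : tangentSections J u) : N →
            EuclideanSpace ℝ (Fin (k + 1))) y i) x =
            mvfderiv J (fun y ↦ (w : N → EuclideanSpace ℝ (Fin (k + 1))) y i) x :=
          mvfderiv_congr_of_eventuallyEq hsum
        have hd2 : mvfderiv J (fun y ↦ (v : N → EuclideanSpace ℝ (Fin (k + 1))) y i) x = 0 := by
          rw [mvfderiv_congr_of_eventuallyEq hvi]
          exact mvfderiv_const (I := J) (0 : ℝ)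
        have hv0 : (v : N → EuclideanSpace ℝ (Fin (k + 1))) x i = 0 := by
          have := hv.eq_of_nhds
          simp [this]
        have hc1 : ((T₁ v : tangentSections J u) : N → EuclideanSpace ℝ (Fin (k + 1))) =
            (v : N → EuclideanSpace ℝ (Fin (k + 1))) := rfl
        have hc2 : ((T₂ w : tangentSections J u) : N → EuclideanSpace ℝ (Fin (k + 1))) =
            (w : N → EuclideanSpace ℝ (Fin (k + 1))) := rfl
        simp only [hc1, hc2]
        rw [hd1, hsum.eq_of_nhds, hd2, hv0]
        simp [PseudoRiemannianMetric.innerDual]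
      · -- `w = 0` near `x`
        have hwi : (fun y ↦ (w : N → EuclideanSpace ℝ (Fin (k + 1))) y i) =ᶠ[𝓝 x] fun _ ↦ 0 :=
          hw.mono fun y hy ↦ by simp [hy]
        have hsum : (fun y ↦ ((T₁ v + T₂ w : tangentSections J u) : N → EuclideanSpace ℝ (Fin (k + 1))) y i)
            =ᶠ[𝓝 x] fun y ↦ (v : N → EuclideanSpace ℝ (Fin (k + 1))) y i := by
          rw [hcoe]
          exact hw.mono fun y hy ↦ by simp [hy]
        have hd1 : mvfderiv J (fun y ↦ ((T₁ v + T₂ w : tangentSections J u) : N →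
            EuclideanSpace ℝ (Fin (k + 1))) y i) x =
            mvfderiv J (fun y ↦ (v : N → EuclideanSpace ℝ (Fin (k + 1))) y i) x :=
          mvfderiv_congr_of_eventuallyEq hsum
        have hd2 : mvfderiv J (fun y ↦ (w : N → EuclideanSpace ℝ (Fin (k + 1))) y i) x = 0 := by
          rw [mvfderiv_congr_of_eventuallyEq hwi]
          exact mvfderiv_const (I := J) (0 : ℝ)
        have hw0 : (w : N → EuclideanSpace ℝ (Fin (k + 1))) x i = 0 := by
          have := hw.eq_of_nhds
          simp [this]
        have hc1 : ((T₁ v : tangentSections J u) : N → EuclideanSpace ℝ (Fin (k + 1))) =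
            (v : N → EuclideanSpace ℝ (Fin (k + 1))) := rfl
        have hc2 : ((T₂ w : tangentSections J u) : N → EuclideanSpace ℝ (Fin (k + 1))) =
            (w : N → EuclideanSpace ℝ (Fin (k + 1))) := rfl
        simp only [hc1, hc2]
        rw [hd1, hsum.eq_of_nhds, hd2, hw0]
        simp [PseudoRiemannianMetric.innerDual]
    · exact integrable_finsetSum _ fun i _ ↦ by
        have h1 : ContMDiff J 𝓘(ℝ, ℝ) 1 (fun y ↦ ((T₁ v : tangentSections J u) : N →
            EuclideanSpace ℝ (Fin (k + 1))) y i) := contMDiff_one_of_mem (sectionCoord J u i (T₁ v))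
        refine (integrable_schrodingerDensity h (continuous_energyDensity h hu) h1 h1).congr ?_
        exact Eventually.of_forall fun x ↦ by simp [schrodingerDensity, sq]
    · exact integrable_finsetSum _ fun i _ ↦ by
        have h1 : ContMDiff J 𝓘(ℝ, ℝ) 1 (fun y ↦ ((T₂ w : tangentSections J u) : N →
            EuclideanSpace ℝ (Fin (k + 1))) y i) := contMDiff_one_of_mem (sectionCoord J u i (T₂ w))
        refine (integrable_schrodingerDensity h (continuous_energyDensity h hu) h1 h1).congr ?_
        exact Eventually.of_forall fun x ↦ by simp [schrodingerDensity, sq]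
  exact negIndex_comp_add_negIndex_comp_le (secondVariation h hu) T₁ T₂ h₁ h₂ hdisjR hadd

omit [(ofRiemannian h).HasLeviCivita] in
/-- **The local index on a ball is at most `3`** (proof of Lemma 3.7, p. 752): if
`ind_E(u) ≤ k + 1` and `ind_E(u; Bᶜ) ≥ k − 2` (Lemma 3.6) then `ind_E(u; B) ≤ 3`.
[cite: KarpukhinStern2024, proof of Lemma 3.7 p. 752] -/
theorem energyIndexOn_le_three {u : N → Metric.sphere (0 : EuclideanSpace ℝ (Fin (k + 1))) 1}
    (hu : ContMDiff J (𝓡 k) ∞ u) (hind : energyIndex h hu ≤ (k + 1 : ℕ)) {B : Set N}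
    (hcompl : ((k - 2 : ℕ) : ℕ∞) ≤ energyIndexOn h hu Bᶜ) (hk : 2 ≤ k) :
    energyIndexOn h hu B ≤ 3 := by
  have hadd := energyIndexOn_add_le h hu (Ω₁ := B) (Ω₂ := Bᶜ) disjoint_compl_right
  have h1 : energyIndexOn h hu B + ((k - 2 : ℕ) : ℕ∞) ≤ (k + 1 : ℕ) :=
    le_trans (by gcongr) (hadd.trans hind)
  -- `ind(B)` is finite
  have hfin : energyIndexOn h hu B ≠ ⊤ := by
    intro htop
    rw [htop, top_add] at h1
    exact absurd h1 (by simp)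
  lift energyIndexOn h hu B to ℕ using hfin with n hn
  have h2 : ((n + (k - 2) : ℕ) : ℕ∞) ≤ (k + 1 : ℕ) := by exact_mod_cast h1
  have h3 : n + (k - 2) ≤ k + 1 := by exact_mod_cast h2
  have h4 : n ≤ 3 := by omega
  exact_mod_cast h4

end Hemisphere

end KarpukhinStern

end Literature.Geometry.Riemannian
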